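import Literature.Topology.FourManifolds.GLLoopClasses
import Literature.Topology.FourManifolds.HomotopySpheresStablyParallelizableProofs
import Literature.Topology.FourManifolds.Cobordism
import HarnessLib

/-!
# Stable frames along circles, discs and spheres: comparison loops, the extension class
# `e(F, D) ∈ ℤ/2`, and the framing obstruction of a sphere map

Topic `Literature/Topology/FourManifolds`. Second module (after `GLLoopClasses.lean`) of the proof
of the twisted-framing exclusion in the middle-level fact
`Literature.Topology.FourManifolds.exists_middleLevel_isStabilization_of_isHCobordism` (R. Kirby,
*The topology of 4-manifolds*, LNM 1374 (1989), Ch. X p. 55: *"The framing is zero in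
`π₁(SO(3)) = ℤ/2` because `W` is spin"*). Spin structures are absent from Mathlib and the tree has
them only as the surface criterion `IsSpin` (`Spin.lean`); what the proof actually uses is the
obstruction to framing the stable tangent bundle along a **sphere**, and its comparison with the
framing of a tubular neighbourhood of an attaching **circle** bounding a **disc**. This file builds
that calculus on the tree's stable frame fields along maps
(`Literature.Topology.FourManifolds.IsStableFrameFieldOn`, `HasStableTangentFramingAlong`,
`HomotopySpheresStablyParallelizable{,Proofs}.lean`), in the chart-free form in which it is
consumed downstream; classically it is the statement that `w₂` of an oriented bundle over `S²` is
read on the equator as the class in `π₁ SO` of the clutching map of two hemisphere trivialisations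
(Kirby 1989, Ch. IV p. 33 and Ch. II §4 p. 27; Milnor–Stasheff §18; Steenrod §26).

* §1 stable frames `Fr m` of `ℝᵐ` (families of `m + 1` vectors of `ℝᵐ × ℝ`), coordinate matrices,
  the **comparison matrix** `compMat A B` ("`A` in the basis `B`", `A = B · compMat A B`), its chain
  rule, invariance under linear automorphisms, the right action `act`, and continuity of
  `compMat` on pairs with `B` linearly independent.
* §2 loops `C(𝕊¹, NzMat n)` of invertible matrices of either sign and their class
  `clsGL ∈ ZMod 2` (the class `GLLoop.cls` of the positive representative `P₀^ε · L`):
  homotopy invariance, additivity `clsGL_mul` (size `≥ 3`), loops extending over the disc have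
  class `0`, stability `clsGL_stabGL`.
* §3 frame fields along maps into a `C¹` manifold `M` modelled on `ℝᵐ`: reading in a chart,
  continuity of the comparison matrix of two frame fields along the same map
  (`continuousOn_compMat_frameField`), the **comparison loop** `compLoopGL F₁ F₂` of two frame
  fields along the same circle map, and the frame field `F · C` for a continuous family of
  invertible matrices (`IsStableFrameFieldOn.act`).
* §4 discs `𝔻² → M`: every disc map carries a stable frame field (contractibility and the tree's
  covering homotopy theorem), the **extension class** `eClass D F ∈ ZMod 2` of a stable frame `F`
  along the boundary circle (class of the comparison loop with a disc frame), its independence of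
  the disc frame (`eClass_eq`), vanishing on restrictions of disc frames (`eClass_bd`), and
  `eClass_act : e(F · C, D) = e(F, D) + clsGL C`.
* §5 transport: `e(F, D)` is preserved by push-forward along `C¹` maps with injective differential
  between manifolds of the same dimension (`eClass_push`; diffeomorphisms, open embeddings) and by
  the lift to one dimension more along an embedding with a nowhere-tangent transverse field
  (`liftFr`, `IsStableFrameFieldOn.lift`, `eClass_lift`: a regular level of a Morse function in a
  cobordism, with the gradient-like field).
* §6 spheres: hemispheres over the disc, the equator, the discs `discUp g`, `discDown g` of a
  sphere map and the sphere `glue D₁ D₂` of two disc maps with common boundary; the main theorem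
  `framed_iff_eClass_eq`: **`TM ⊕ ℝ` is framed along `g : 𝕊² → M` iff `e(F, D₊) = e(F, D₋)`** for
  one (equivalently every) stable frame `F` along the equator map — necessity by restricting a
  global framing, sufficiency by extending the class-`0` comparison loop of two disc frames over
  the disc (the tree's `exists_sphere_extends_of_nullhomotopic`), twisting one disc frame by it and
  pasting along the equator (`IsStableFrameFieldOn.union`); and `framed_glue_iff`,
  `framed_glue_self`.

Everything is proved; no named facts are introduced.

## References

* R. C. Kirby, *The topology of 4-manifolds*, LNM 1374 (1989), Ch. IV p. 33 (spin structures as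
  trivialisations over the 2-skeleton), Ch. II §4 p. 27 (`w₂` is the only obstruction), Ch. X p. 55.
  [Kirby1989]
* R. E. Gompf, A. I. Stipsicz, *4-Manifolds and Kirby Calculus*, GSM 20 (1999), §5.2 (framings of
  circles and `π₁ SO(3) = ℤ/2`). [GompfStipsiczGSM1999]
* A. Hatcher, *Algebraic Topology*, CUP (2002), §4.2, Example 4.55 (stability of `π₁ SO(n)`).
  [HatcherAT2002]
-/

noncomputable section

open Set Function Metric Matrix Topology Bundle Module
open scoped Topology unitInterval Manifold ContDiff

namespace Literature.Topology.FourManifolds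

namespace StableFrames

open GLLoop GLLoop.PosMat BoundaryManifold

/-- Local notation: `𝔼 n` is the model Euclidean space `EuclideanSpace ℝ (Fin n)`. -/
local notation "𝔼 " n:arg => EuclideanSpace ℝ (Fin n)

/-- Local notation: the unit circle. -/
local notation "𝕊¹" => (sphere (0 : EuclideanSpace ℝ (Fin (1 + 1))) 1)

/-! ### 1. Stable frames of `ℝᵐ`: coordinates and comparison matrices -/

section Algebra

variable {m : ℕ}

/-- A **stable frame** candidate: `m + 1` vectors of `ℝᵐ × ℝ` (a frame when linearly independent).
[folklore] -/
abbrev Fr (m : ℕ) : Type := Fin (m + 1) → (𝔼 m) × ℝ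

/-- The standard basis of `ℝᵐ × ℝ ≅ ℝᵐ⁺¹` (first vector the extra direction `(0, 1)`, then the
coordinate vectors of `ℝᵐ`; the tree's `consCLE`). [folklore] -/
def stdB (m : ℕ) : Basis (Fin (m + 1)) ℝ ((𝔼 m) × ℝ) :=
  (EuclideanSpace.basisFun (Fin (m + 1)) ℝ).toBasis.map (consCLE m).symm.toLinearEquiv

/-- Coordinates in the standard basis are the `consCLE` coordinates. [folklore] -/
theorem stdB_repr (v : (𝔼 m) × ℝ) (i : Fin (m + 1)) : (stdB m).repr v i = consCLE m v i := by
  simp [stdB, Basis.map_repr]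

/-- The **coordinate matrix** of a family: column `j` holds the coordinates of `F j`. [folklore] -/
def coordMat (F : Fr m) : Matrix (Fin (m + 1)) (Fin (m + 1)) ℝ := (stdB m).toMatrix F

/-- Entries of the coordinate matrix. [folklore] -/
theorem coordMat_apply (F : Fr m) (i j : Fin (m + 1)) : coordMat F i j = consCLE m (F j) i := by
  rw [coordMat, Basis.toMatrix_apply, stdB_repr]

/-- The coordinate matrix depends continuously on the family. [folklore] -/
theorem continuous_coordMat : Continuous (coordMat : Fr m → Matrix (Fin (m + 1)) (Fin (m + 1)) ℝ) := by
  refine continuous_matrix fun i j => ?_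
  simp_rw [coordMat_apply]
  exact (PiLp.continuous_apply 2 _ i).comp ((consCLE m).continuous.comp (continuous_apply j))

/-- A linearly independent family of `m + 1` vectors of `ℝᵐ × ℝ` is a basis. [folklore] -/
def basisOf {F : Fr m} (h : LinearIndependent ℝ F) : Basis (Fin (m + 1)) ℝ ((𝔼 m) × ℝ) :=
  basisOfLinearIndependentOfCardEqFinrank h (by simp)

/-- The vectors of `basisOf h` are those of `F`. [folklore] -/
@[simp] theorem coe_basisOf {F : Fr m} (h : LinearIndependent ℝ F) : ⇑(basisOf h) = F :=
  coe_basisOfLinearIndependentOfCardEqFinrank h _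

/-- A family is linearly independent iff its coordinate matrix has non-zero determinant.
[folklore] -/
theorem linearIndependent_iff_det_coordMat_ne_zero (F : Fr m) :
    LinearIndependent ℝ F ↔ (coordMat F).det ≠ 0 := by
  rw [coordMat, ← Basis.det_apply, ← isUnit_iff_ne_zero, ← Basis.is_basis_iff_det]
  constructor
  · intro h
    exact ⟨h, by rw [← coe_basisOf h]; exact (basisOf h).span_eq⟩
  · exact fun h => h.1

/-- **The comparison matrix** `compMat A B` of two families: when `B` is linearly independent it
is the matrix of `A` in the basis `B`, `A j = ∑ i, compMat A B i j • B i`; otherwise `1`.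
[folklore] -/
def compMat (A B : Fr m) : Matrix (Fin (m + 1)) (Fin (m + 1)) ℝ :=
  open Classical in if h : LinearIndependent ℝ B then (basisOf h).toMatrix A else 1

/-- The comparison matrix with a frame. [folklore] -/
theorem compMat_eq {A B : Fr m} (h : LinearIndependent ℝ B) : compMat A B = (basisOf h).toMatrix A := by
  rw [compMat, dif_pos h]

/-- Reconstruction: `A j = ∑ i, compMat A B i j • B i`. [folklore] -/
theorem sum_compMat_smul {A B : Fr m} (h : LinearIndependent ℝ B) (j : Fin (m + 1)) :
    ∑ i, compMat A B i j • B i = A j := by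
  rw [compMat_eq h]
  have := (basisOf h).sum_toMatrix_smul_self (v := A) (j := j)
  simpa only [coe_basisOf] using this

/-- `compMat B B = 1`. [folklore] -/
theorem compMat_self {B : Fr m} (h : LinearIndependent ℝ B) : compMat B B = 1 := by
  have h1 : (basisOf h).toMatrix B = (basisOf h).toMatrix (basisOf h) := by rw [coe_basisOf]
  rw [compMat_eq h, h1]
  exact (basisOf h).toMatrix_self

/-- Chain rule: `compMat A C = compMat B C * compMat A B`. [folklore] -/
theorem compMat_mul_compMat {A B C : Fr m} (hB : LinearIndependent ℝ B) (hC : LinearIndependent ℝ C) :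
    compMat B C * compMat A B = compMat A C := by
  rw [compMat_eq hB, compMat_eq hC, compMat_eq hC]
  have := (basisOf hC).toMatrix_mul_toMatrix (b' := basisOf hB) A
  rwa [coe_basisOf hB] at this

/-- The comparison matrix in coordinates: `compMat A B = (coordMat B)⁻¹ * coordMat A`. [folklore] -/
theorem compMat_eq_coord {A B : Fr m} (h : LinearIndependent ℝ B) :
    compMat A B = (coordMat B)⁻¹ * coordMat A := by
  have hflip : (basisOf h).toMatrix (stdB m) * (stdB m).toMatrix (basisOf h) = 1 :=
    (basisOf h).toMatrix_mul_toMatrix_flip (stdB m)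
  have hflip' : (stdB m).toMatrix (basisOf h) * (basisOf h).toMatrix (stdB m) = 1 :=
    (stdB m).toMatrix_mul_toMatrix_flip (basisOf h)
  have hcoe : coordMat B = (stdB m).toMatrix (basisOf h) := by rw [coe_basisOf]; rfl
  have hinv : (coordMat B)⁻¹ = (basisOf h).toMatrix (stdB m) := by
    rw [hcoe]
    exact Matrix.inv_eq_left_inv hflip
  rw [hinv, compMat_eq h, coordMat]
  exact ((basisOf h).toMatrix_mul_toMatrix (b' := stdB m) A).symm

/-- The comparison matrix of two frames is invertible. [folklore] -/
theorem det_compMat_ne_zero {A B : Fr m} (hA : LinearIndependent ℝ A) (hB : LinearIndependent ℝ B) :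
    (compMat A B).det ≠ 0 := by
  rw [compMat_eq_coord hB, det_mul, det_nonsing_inv, Ring.inverse_eq_inv']
  exact mul_ne_zero (inv_ne_zero ((linearIndependent_iff_det_coordMat_ne_zero B).mp hB))
    ((linearIndependent_iff_det_coordMat_ne_zero A).mp hA)

/-- `det (compMat A C) = det (compMat B C) * det (compMat A B)`. [folklore] -/
theorem det_compMat_mul {A B C : Fr m} (hB : LinearIndependent ℝ B) (hC : LinearIndependent ℝ C) :
    (compMat A C).det = (compMat B C).det * (compMat A B).det := by
  rw [← compMat_mul_compMat hB hC, det_mul]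

/-- **Equivariance**: applying a linear automorphism to both families does not change the
comparison matrix. [folklore] -/
theorem compMat_map (T : ((𝔼 m) × ℝ) ≃ₗ[ℝ] ((𝔼 m) × ℝ)) {A B : Fr m} (hB : LinearIndependent ℝ B) :
    compMat (T ∘ A) (T ∘ B) = compMat A B := by
  have hTB : LinearIndependent ℝ (T ∘ B) := hB.map' T.toLinearMap T.ker
  rw [compMat_eq hB, compMat_eq hTB]
  have hb : basisOf hTB = (basisOf hB).map T := by
    apply Basis.eq_of_apply_eq
    intro i
    rw [coe_basisOf, Basis.map_apply, coe_basisOf]; rfl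
  rw [hb, Basis.toMatrix_map]
  congr 1
  funext j
  exact (T.symm_apply_apply (A j))

/-! ### The right action of matrices on frames -/

/-- **Right action** of a matrix on a family: `(F · C) j = ∑ i, C i j • F i`. [folklore] -/
def act (F : Fr m) (C : Matrix (Fin (m + 1)) (Fin (m + 1)) ℝ) : Fr m := fun j => ∑ i, C i j • F i

/-- The identity acts trivially. [folklore] -/
theorem act_one (F : Fr m) : act F 1 = F := by
  funext j
  simp [act, Matrix.one_apply, Finset.sum_ite_eq']

/-- The action is compatible with products. [folklore] -/
theorem act_mul (F : Fr m) (C D : Matrix (Fin (m + 1)) (Fin (m + 1)) ℝ) : act F (C * D) = act (act F C) D := by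
  funext j
  simp only [act, Matrix.mul_apply, Finset.sum_smul, Finset.smul_sum, smul_smul]
  rw [Finset.sum_comm]
  refine Finset.sum_congr rfl fun i _ => Finset.sum_congr rfl fun k _ => by ring_nf

/-- `B · compMat A B = A`. [folklore] -/
theorem act_compMat {A B : Fr m} (h : LinearIndependent ℝ B) : act B (compMat A B) = A := by
  funext j
  exact sum_compMat_smul h j

/-- `compMat (F · C) F = C` for a frame `F`. [folklore] -/
theorem compMat_act_self {F : Fr m} (h : LinearIndependent ℝ F) (C : Matrix (Fin (m + 1)) (Fin (m + 1)) ℝ) :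
    compMat (act F C) F = C := by
  rw [compMat_eq h]
  ext i j
  rw [Basis.toMatrix_apply]
  change (basisOf h).repr (∑ k, C k j • F k) i = C i j
  have hr : ∀ k, (basisOf h).repr (F k) = Finsupp.single k 1 := fun k => by
    have hk : F k = basisOf h k := by rw [coe_basisOf]
    rw [hk]; exact (basisOf h).repr_self k
  rw [map_sum]
  simp_rw [map_smul, hr]
  rw [Finset.sum_apply']
  simp [Finsupp.single_apply]

/-- `compMat (A · C) B = compMat A B * C`. [folklore] -/
theorem compMat_act {A B : Fr m} (hB : LinearIndependent ℝ B) (C : Matrix (Fin (m + 1)) (Fin (m + 1)) ℝ) :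
    compMat (act A C) B = compMat A B * C := by
  have h1 : act A C = act B (compMat A B * C) := by rw [act_mul, act_compMat hB]
  rw [h1, compMat_act_self hB]

/-- A frame acted on by an invertible matrix is a frame. [folklore] -/
theorem linearIndependent_act {F : Fr m} (h : LinearIndependent ℝ F) {C : Matrix (Fin (m + 1)) (Fin (m + 1)) ℝ}
    (hC : C.det ≠ 0) : LinearIndependent ℝ (act F C) := by
  rw [linearIndependent_iff_det_coordMat_ne_zero] at h ⊢
  have : coordMat (act F C) = coordMat F * C := by
    have := compMat_act (stdB m).linearIndependent C (A := F)
    -- `coordMat = compMat · stdB`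
    have hc : ∀ G : Fr m, coordMat G = compMat G (stdB m) := fun G => by
      rw [compMat_eq (stdB m).linearIndependent, coordMat]
      congr 1
      exact (Basis.eq_of_apply_eq fun i => by rw [coe_basisOf]).symm
    rw [hc, hc, this]
  rw [this, det_mul]
  exact mul_ne_zero h hC

/-- The action is continuous. [folklore] -/
theorem continuous_act : Continuous fun p : Fr m × Matrix (Fin (m + 1)) (Fin (m + 1)) ℝ => act p.1 p.2 := by
  refine continuous_pi fun j => ?_
  refine continuous_finsetSum _ fun i _ => ?_
  exact ((continuous_snd.matrix_elem i j).smul ((continuous_apply i).comp continuous_fst))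

/-! ### Continuity of comparison matrices, inverses -/

/-- Matrix inversion is continuous on invertible matrices. [folklore] -/
theorem continuousOn_matrix_inv {n : Type*} [Fintype n] [DecidableEq n] :
    ContinuousOn (fun A : Matrix n n ℝ => A⁻¹) {A | A.det ≠ 0} := by
  have : ∀ A : Matrix n n ℝ, A⁻¹ = (A.det)⁻¹ • A.adjugate := fun A => by
    rw [Matrix.inv_def, Ring.inverse_eq_inv']
  simp_rw [this]
  have h1 : ContinuousOn (fun A : Matrix n n ℝ => (A.det)⁻¹) {A | A.det ≠ 0} :=
    ((continuous_id (X := Matrix n n ℝ)).matrix_det.continuousOn).inv₀ fun A hA => hA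
  have h2 : ContinuousOn (fun A : Matrix n n ℝ => A.adjugate) {A | A.det ≠ 0} :=
    (continuous_id (X := Matrix n n ℝ)).matrix_adjugate.continuousOn
  exact h1.smul h2

/-- **The comparison matrix of two continuously varying frames varies continuously.** [folklore] -/
theorem continuousOn_compMat {X : Type*} [TopologicalSpace X] {A B : X → Fr m} {s : Set X}
    (hA : ContinuousOn A s) (hB : ContinuousOn B s) (hBli : ∀ x ∈ s, LinearIndependent ℝ (B x)) :
    ContinuousOn (fun x => compMat (A x) (B x)) s := by
  have heq : ∀ x ∈ s, compMat (A x) (B x) = (coordMat (B x))⁻¹ * coordMat (A x) := fun x hx =>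
    compMat_eq_coord (hBli x hx)
  refine ContinuousOn.congr ?_ heq
  refine ContinuousOn.mul ?_ (continuous_coordMat.comp_continuousOn hA)
  refine continuousOn_matrix_inv.comp (continuous_coordMat.comp_continuousOn hB) fun x hx => ?_
  exact (linearIndependent_iff_det_coordMat_ne_zero _).mp (hBli x hx)

end Algebra

/-! ### 2. Loops of invertible matrices of either sign: the class `clsGL` -/

section GLClass

variable {n : ℕ}

/-- Invertible real matrices, as a subtype. [folklore] -/
def NzMat (n : ℕ) : Type := {A : Matrix (Fin n) (Fin n) ℝ // A.det ≠ 0}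

namespace NzMat

/-- The subspace topology. [folklore] -/
instance : TopologicalSpace (NzMat n) := instTopologicalSpaceSubtype

/-- The underlying matrix is continuous. [folklore] -/
theorem continuous_val : Continuous (Subtype.val : NzMat n → Matrix (Fin n) (Fin n) ℝ) := continuous_subtype_val

/-- The identity matrix. [folklore] -/
instance : One (NzMat n) := ⟨⟨1, by rw [det_one]; exact one_ne_zero⟩⟩

/-- Products of invertible matrices. [folklore] -/
instance : Mul (NzMat n) := ⟨fun A B => ⟨A.1 * B.1, by rw [det_mul]; exact mul_ne_zero A.2 B.2⟩⟩

/-- The identity, as a matrix. [folklore] -/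
@[simp] theorem one_val : (1 : NzMat n).1 = 1 := rfl

/-- Products, as matrices. [folklore] -/
@[simp] theorem mul_val (A B : NzMat n) : (A * B).1 = A.1 * B.1 := rfl

/-- Multiplication is continuous. [folklore] -/
instance : ContinuousMul (NzMat n) :=
  ⟨((continuous_val.comp continuous_fst).mul (continuous_val.comp continuous_snd)).subtype_mk _⟩

/-- Invertible matrices form a monoid. [folklore] -/
instance : Monoid (NzMat n) where
  mul_assoc A B C := Subtype.ext (Matrix.mul_assoc _ _ _)
  one_mul A := Subtype.ext (Matrix.one_mul _)
  mul_one A := Subtype.ext (Matrix.mul_one _)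

/-- A matrix of positive determinant is invertible. [folklore] -/
def ofPos (A : PosMat n) : NzMat n := ⟨A.1, A.2.ne'⟩

/-- The matrix of `ofPos A`. [folklore] -/
@[simp] theorem ofPos_val (A : PosMat n) : (ofPos A).1 = A.1 := rfl

/-- `ofPos` is continuous. [folklore] -/
theorem continuous_ofPos : Continuous (ofPos : PosMat n → NzMat n) := PosMat.continuous_val.subtype_mk _

/-- The reflection `P₀ = diag(-1, 1, …, 1)`. [folklore] -/
def P0 (n : ℕ) : Matrix (Fin n) (Fin n) ℝ := Matrix.diagonal fun i => if i.1 = 0 then -1 else 1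

/-- `P₀² = 1`. [folklore] -/
theorem P0_mul_P0 (n : ℕ) : P0 n * P0 n = 1 := by
  rw [P0, Matrix.diagonal_mul_diagonal, ← Matrix.diagonal_one]
  congr 1; funext i; split_ifs <;> norm_num

/-- `det P₀ = -1` for `n ≥ 1`. [folklore] -/
theorem det_P0 (n : ℕ) : (P0 (n + 1)).det = -1 := by
  rw [P0, Matrix.det_diagonal, Fin.prod_univ_succ]
  simp

end NzMat

open NzMat

/-- The sign of the determinant is constant along a loop of invertible matrices. [folklore] -/
theorem NzMat.det_pos_of_det_pos {X : Type*} [TopologicalSpace X] [PreconnectedSpace X]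
    (L : C(X, NzMat n)) {x₀ : X} (h : 0 < (L x₀).1.det) (x : X) : 0 < (L x).1.det := by
  rcases lt_or_gt_of_ne (L x).2 with hlt | hgt
  · exfalso
    have hc : ContinuousOn (fun y => (L y).1.det) univ := (continuous_val.comp L.2).matrix_det.continuousOn
    obtain ⟨s, -, hs⟩ := isPreconnected_univ.intermediate_value₂ (mem_univ x) (mem_univ x₀) hc continuousOn_const
      hlt.le h.le
    exact (L s).2 hs
  · exact hgt

/-- The sign of the determinant is constant along a loop of invertible matrices. [folklore] -/
theorem NzMat.det_neg_of_det_neg {X : Type*} [TopologicalSpace X] [PreconnectedSpace X]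
    (L : C(X, NzMat n)) {x₀ : X} (h : (L x₀).1.det < 0) (x : X) : (L x).1.det < 0 := by
  rcases lt_or_gt_of_ne (L x).2 with hlt | hgt
  · exact hlt
  · exfalso
    have hc : ContinuousOn (fun y => (L y).1.det) univ := (continuous_val.comp L.2).matrix_det.continuousOn
    obtain ⟨s, -, hs⟩ := isPreconnected_univ.intermediate_value₂ (mem_univ x₀) (mem_univ x) hc continuousOn_const
      h.le hgt.le
    exact (L s).2 hs

/-- The base point `(1, 0)` of the circle. [folklore] -/
def u₀ : 𝕊¹ := circlePoint 0

/-- `det (P₀ A) > 0` for `det A < 0`. [folklore] -/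
theorem NzMat.det_P0_mul_pos {A : Matrix (Fin (n + 1)) (Fin (n + 1)) ℝ} (h : A.det < 0) : 0 < (P0 (n + 1) * A).det := by
  rw [det_mul, det_P0]; linarith

open Classical in
/-- **Positive representative** of a loop of invertible matrices: the loop itself if its
determinant is positive, `P₀ · L` otherwise. [folklore] -/
def toPos (L : C(𝕊¹, NzMat (n + 1))) : C(𝕊¹, PosMat (n + 1)) :=
  if h : 0 < (L u₀).1.det then ⟨fun u => ⟨(L u).1, NzMat.det_pos_of_det_pos L h u⟩, (continuous_val.comp L.2).subtype_mk _⟩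
  else ⟨fun u => ⟨P0 (n + 1) * (L u).1,
      NzMat.det_P0_mul_pos (NzMat.det_neg_of_det_neg L (lt_of_le_of_ne (not_lt.mp h) (L u₀).2) u)⟩,
    (continuous_const.mul (continuous_val.comp L.2)).subtype_mk _⟩

/-- The positive representative of a positive loop is the loop. [folklore] -/
theorem toPos_of_pos (L : C(𝕊¹, NzMat (n + 1))) (h : 0 < (L u₀).1.det) (u : 𝕊¹) : (toPos L u).1 = (L u).1 := by
  unfold toPos; rw [dif_pos h]; rfl

/-- The positive representative of a negative loop is `P₀ · L`. [folklore] -/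
theorem toPos_of_neg (L : C(𝕊¹, NzMat (n + 1))) (h : (L u₀).1.det < 0) (u : 𝕊¹) :
    (toPos L u).1 = P0 (n + 1) * (L u).1 := by
  unfold toPos; rw [dif_neg (not_lt.mpr h.le)]; rfl

/-- **The class of a loop of invertible matrices** (either sign of the determinant): the class
of its positive representative. [cite: GompfStipsiczGSM1999, §5.2] -/
def clsGL (L : C(𝕊¹, NzMat (n + 1))) : ZMod 2 := cls (toPos L)

/-- A positive loop, as a loop of invertible matrices. [folklore] -/
def posLoop (L : C(𝕊¹, PosMat (n + 1))) : C(𝕊¹, NzMat (n + 1)) := ⟨fun u => ofPos (L u), continuous_ofPos.comp L.2⟩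

/-- Values of `posLoop`. [folklore] -/
@[simp] theorem posLoop_apply_val (L : C(𝕊¹, PosMat (n + 1))) (u : 𝕊¹) : (posLoop L u).1 = (L u).1 := rfl

/-- Two positive loops with the same matrices have the same class. [folklore] -/
theorem cls_congr_val {L L' : C(𝕊¹, PosMat (n + 1))} (h : ∀ u, (L u).1 = (L' u).1) : cls L = cls L' := by
  have : L = L' := by ext u : 1; exact Subtype.ext (h u)
  rw [this]

/-- `clsGL` extends `cls`. [folklore] -/
theorem clsGL_posLoop (L : C(𝕊¹, PosMat (n + 1))) : clsGL (posLoop L) = cls L :=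
  cls_congr_val fun u => toPos_of_pos (posLoop L) (L u₀).2 u

/-- The class of a positive loop of invertible matrices is the class of the underlying positive
loop. [folklore] -/
theorem clsGL_eq_cls_of_pos (L : C(𝕊¹, NzMat (n + 1))) (h : 0 < (L u₀).1.det) (L' : C(𝕊¹, PosMat (n + 1)))
    (hL' : ∀ u, (L' u).1 = (L u).1) : clsGL L = cls L' :=
  cls_congr_val fun u => by rw [toPos_of_pos L h, hL']

/-- **Homotopy invariance of `clsGL`** for homotopies through invertible matrices. [folklore] -/
theorem clsGL_congr {L L' : C(𝕊¹, NzMat (n + 1))} (h : L.Homotopic L') : clsGL L = clsGL L' := by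
  obtain ⟨H⟩ := h
  haveI : PreconnectedSpace (I × 𝕊¹) := by
    haveI : PreconnectedSpace I := Subtype.preconnectedSpace isPreconnected_Icc
    infer_instance
  by_cases hs : 0 < (L u₀).1.det
  · have hall : ∀ p, 0 < (H p).1.det := NzMat.det_pos_of_det_pos H.toContinuousMap
      (x₀ := ((0 : I), u₀)) (by change 0 < (H (0, u₀)).1.det; rw [H.apply_zero]; exact hs)
    have hs' : 0 < (L' u₀).1.det := by have := hall (1, u₀); rwa [H.apply_one] at this
    exact cls_congr
      ⟨{ toFun := fun p => ⟨(H p).1, hall p⟩,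
         continuous_toFun := (continuous_val.comp H.continuous).subtype_mk _,
         map_zero_left := fun u => Subtype.ext (by rw [toPos_of_pos L hs]; change (H (0, u)).1 = _; rw [H.apply_zero]),
         map_one_left := fun u => Subtype.ext (by rw [toPos_of_pos L' hs']; change (H (1, u)).1 = _; rw [H.apply_one]) }⟩
  · have hneg : (L u₀).1.det < 0 := lt_of_le_of_ne (not_lt.mp hs) (L u₀).2
    have hall : ∀ p, (H p).1.det < 0 := NzMat.det_neg_of_det_neg H.toContinuousMap
      (x₀ := ((0 : I), u₀)) (by change (H (0, u₀)).1.det < 0; rw [H.apply_zero]; exact hneg)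
    have hs' : (L' u₀).1.det < 0 := by have := hall (1, u₀); rwa [H.apply_one] at this
    exact cls_congr
      ⟨{ toFun := fun p => ⟨P0 (n + 1) * (H p).1, NzMat.det_P0_mul_pos (hall p)⟩,
         continuous_toFun := (continuous_const.mul (continuous_val.comp H.continuous)).subtype_mk _,
         map_zero_left := fun u => Subtype.ext (by
           rw [toPos_of_neg L hneg]; change P0 (n + 1) * (H (0, u)).1 = _; rw [H.apply_zero]),
         map_one_left := fun u => Subtype.ext (by
           rw [toPos_of_neg L' hs']; change P0 (n + 1) * (H (1, u)).1 = _; rw [H.apply_one]) }⟩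

/-- Constant loops have class `0`. [folklore] -/
theorem clsGL_const (A : NzMat (n + 1)) : clsGL (ContinuousMap.const 𝕊¹ A) = 0 := by
  by_cases h : 0 < A.1.det
  · rw [clsGL_eq_cls_of_pos _ h (ContinuousMap.const 𝕊¹ ⟨A.1, h⟩) fun u => rfl]; exact cls_const _
  · have hneg : A.1.det < 0 := lt_of_le_of_ne (not_lt.mp h) A.2
    have : clsGL (ContinuousMap.const 𝕊¹ A) = cls (ContinuousMap.const 𝕊¹ ⟨P0 (n + 1) * A.1, NzMat.det_P0_mul_pos hneg⟩) :=
      cls_congr_val fun u => toPos_of_neg _ hneg u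
    rw [this]; exact cls_const _

/-- **A loop of invertible matrices which extends continuously over the disc has class `0`.**
[folklore] -/
theorem clsGL_eq_zero_of_extends (L : C(𝕊¹, NzMat (n + 1)))
    (G : C(↥(closedBall (0 : EuclideanSpace ℝ (Fin (1 + 1))) 1), NzMat (n + 1)))
    (hG : ∀ u : 𝕊¹, G ⟨u.1, sphere_subset_closedBall u.2⟩ = L u) : clsGL L = 0 := by
  -- contract the disc
  have hh : L.Homotopic (ContinuousMap.const 𝕊¹ (G ⟨0, by simp⟩)) := by
    refine ⟨{ toFun := fun p => G ⟨(1 - (p.1 : ℝ)) • (p.2 : EuclideanSpace ℝ (Fin (1 + 1))), ?_⟩,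
              continuous_toFun := ?_,
              map_zero_left := fun u => ?_,
              map_one_left := fun u => ?_ }⟩
    · rw [mem_closedBall, dist_zero_right, norm_smul, norm_eq_of_mem_sphere p.2, mul_one, Real.norm_eq_abs,
        abs_of_nonneg (by linarith [p.1.2.2])]
      linarith [p.1.2.1]
    · exact G.continuous.comp (((continuous_const.sub (continuous_subtype_val.comp continuous_fst)).smul
        (continuous_subtype_val.comp continuous_snd)).subtype_mk _)
    · rw [← hG u]; congr 1; apply Subtype.ext; simp
    · change G _ = G _
      congr 1; apply Subtype.ext; simp
  rw [clsGL_congr hh]; exact clsGL_const _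

/-- `det (P₀ A P₀) = det A`. [folklore] -/
theorem det_P0_conj (A : Matrix (Fin (n + 1)) (Fin (n + 1)) ℝ) : (P0 (n + 1) * A * P0 (n + 1)).det = A.det := by
  rw [det_mul, det_mul, det_P0]; ring

/-- Conjugation by `P₀` in `GL⁺`. [folklore] -/
def PosMat.conjP0 (A : PosMat (n + 1)) : PosMat (n + 1) :=
  ⟨P0 (n + 1) * A.1 * P0 (n + 1), by rw [det_P0_conj]; exact A.2⟩

/-- Conjugation by `P₀` is continuous. [folklore] -/
theorem PosMat.continuous_conjP0 : Continuous (PosMat.conjP0 : PosMat (n + 1) → PosMat (n + 1)) :=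
  ((continuous_const.mul PosMat.continuous_val).mul continuous_const).subtype_mk _

/-- Conjugation by `P₀` of a positive loop. [folklore] -/
def conjP0 (L : C(𝕊¹, PosMat (n + 1))) : C(𝕊¹, PosMat (n + 1)) :=
  ⟨fun u => PosMat.conjP0 (L u), PosMat.continuous_conjP0.comp L.2⟩

/-- Values of `conjP0`. [folklore] -/
@[simp] theorem conjP0_apply_val (L : C(𝕊¹, PosMat (n + 1))) (u : 𝕊¹) :
    (conjP0 L u).1 = P0 (n + 1) * (L u).1 * P0 (n + 1) := rfl

/-- `conjP0` is an involution. [folklore] -/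
theorem conjP0_conjP0 (L : C(𝕊¹, PosMat (n + 1))) : conjP0 (conjP0 L) = L := by
  ext u : 1; apply Subtype.ext
  have hP := P0_mul_P0 (n + 1)
  change P0 (n + 1) * (P0 (n + 1) * (L u).1 * P0 (n + 1)) * P0 (n + 1) = (L u).1
  calc P0 (n + 1) * (P0 (n + 1) * (L u).1 * P0 (n + 1)) * P0 (n + 1)
        = (P0 (n + 1) * P0 (n + 1)) * (L u).1 * (P0 (n + 1) * P0 (n + 1)) := by
          simp only [Matrix.mul_assoc]
    _ = (L u).1 := by rw [hP, Matrix.one_mul, Matrix.mul_one]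

/-- Null-homotopy is invariant under conjugation by `P₀`. [folklore] -/
theorem nullhomotopic_conjP0 {L : C(𝕊¹, PosMat (n + 1))} (h : L.Nullhomotopic) : (conjP0 L).Nullhomotopic := by
  obtain ⟨A, ⟨H⟩⟩ := h
  refine ⟨PosMat.conjP0 A, ⟨?_⟩⟩
  exact
    { toFun := fun p => PosMat.conjP0 (H p),
      continuous_toFun := PosMat.continuous_conjP0.comp H.continuous,
      map_zero_left := fun u => by rw [H.apply_zero]; rfl,
      map_one_left := fun u => by rw [H.apply_one]; rfl }

/-- The class is invariant under conjugation by `P₀`. [folklore] -/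
theorem cls_conjP0 (L : C(𝕊¹, PosMat (n + 1))) : cls (conjP0 L) = cls L := by
  by_cases h : L.Nullhomotopic
  · rw [cls_of_nullhomotopic h, cls_of_nullhomotopic (nullhomotopic_conjP0 h)]
  · rw [(cls_eq_one_iff L).mpr h, (cls_eq_one_iff _).mpr fun h' => h ?_]
    have := nullhomotopic_conjP0 h'
    rwa [conjP0_conjP0] at this

/-- **Additivity of `clsGL`** for pointwise products of loops of invertible matrices (size `≥ 3`).
[cite: GompfStipsiczGSM1999, §5.2] -/
theorem clsGL_mul (hn : 3 ≤ n + 1) (L₁ L₂ : C(𝕊¹, NzMat (n + 1))) : clsGL (L₁ * L₂) = clsGL L₁ + clsGL L₂ := by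
  have hP : P0 (n + 1) * P0 (n + 1) = 1 := P0_mul_P0 _
  by_cases h₁ : 0 < (L₁ u₀).1.det <;> by_cases h₂ : 0 < (L₂ u₀).1.det
  · -- `+ +`
    have h12 : 0 < ((L₁ * L₂) u₀).1.det := by
      change 0 < ((L₁ u₀).1 * (L₂ u₀).1).det; rw [det_mul]; exact mul_pos h₁ h₂
    rw [clsGL_eq_cls_of_pos _ h12 (toPos L₁ * toPos L₂) fun u => by
      change (toPos L₁ u).1 * (toPos L₂ u).1 = (L₁ u).1 * (L₂ u).1
      rw [toPos_of_pos L₁ h₁, toPos_of_pos L₂ h₂]]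
    exact cls_mul hn _ _
  · -- `+ -`
    have h₂' : (L₂ u₀).1.det < 0 := lt_of_le_of_ne (not_lt.mp h₂) (L₂ u₀).2
    have h12 : ((L₁ * L₂) u₀).1.det < 0 := by
      change ((L₁ u₀).1 * (L₂ u₀).1).det < 0; rw [det_mul]; exact mul_neg_of_pos_of_neg h₁ h₂'
    have : clsGL (L₁ * L₂) = cls (conjP0 (toPos L₁) * toPos L₂) := by
      refine cls_congr_val fun u => ?_
      rw [toPos_of_neg _ h12]
      change P0 (n + 1) * ((L₁ u).1 * (L₂ u).1) = P0 (n + 1) * (toPos L₁ u).1 * P0 (n + 1) * (toPos L₂ u).1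
      rw [toPos_of_pos L₁ h₁, toPos_of_neg L₂ h₂', Matrix.mul_assoc _ (P0 (n + 1)), ← Matrix.mul_assoc (P0 (n + 1)) (P0 (n + 1)),
        hP, Matrix.one_mul, Matrix.mul_assoc]
    rw [this, cls_mul hn, cls_conjP0]; rfl
  · -- `- +`
    have h₁' : (L₁ u₀).1.det < 0 := lt_of_le_of_ne (not_lt.mp h₁) (L₁ u₀).2
    have h12 : ((L₁ * L₂) u₀).1.det < 0 := by
      change ((L₁ u₀).1 * (L₂ u₀).1).det < 0; rw [det_mul]; exact mul_neg_of_neg_of_pos h₁' h₂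
    have : clsGL (L₁ * L₂) = cls (toPos L₁ * toPos L₂) := by
      refine cls_congr_val fun u => ?_
      rw [toPos_of_neg _ h12]
      change P0 (n + 1) * ((L₁ u).1 * (L₂ u).1) = (toPos L₁ u).1 * (toPos L₂ u).1
      rw [toPos_of_neg L₁ h₁', toPos_of_pos L₂ h₂, Matrix.mul_assoc]
    rw [this, cls_mul hn]; rfl
  · -- `- -`
    have h₁' : (L₁ u₀).1.det < 0 := lt_of_le_of_ne (not_lt.mp h₁) (L₁ u₀).2
    have h₂' : (L₂ u₀).1.det < 0 := lt_of_le_of_ne (not_lt.mp h₂) (L₂ u₀).2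
    have h12 : 0 < ((L₁ * L₂) u₀).1.det := by
      change 0 < ((L₁ u₀).1 * (L₂ u₀).1).det; rw [det_mul]; exact mul_pos_of_neg_of_neg h₁' h₂'
    have : clsGL (L₁ * L₂) = cls (conjP0 (toPos L₁) * toPos L₂) := by
      refine (clsGL_eq_cls_of_pos _ h12 _ fun u => ?_)
      change P0 (n + 1) * (toPos L₁ u).1 * P0 (n + 1) * (toPos L₂ u).1 = (L₁ u).1 * (L₂ u).1
      rw [toPos_of_neg L₁ h₁', toPos_of_neg L₂ h₂', ← Matrix.mul_assoc (P0 (n + 1)) (P0 (n + 1)), hP, Matrix.one_mul,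
        Matrix.mul_assoc _ (P0 (n + 1)), ← Matrix.mul_assoc (P0 (n + 1)) (P0 (n + 1)), hP, Matrix.one_mul]
    rw [this, cls_mul hn, cls_conjP0]; rfl

/-- `clsGL` of the pointwise inverse loop. [folklore] -/
theorem clsGL_inv_eq (hn : 3 ≤ n + 1) (L L' : C(𝕊¹, NzMat (n + 1))) (h : ∀ u, (L u).1 * (L' u).1 = 1) :
    clsGL L' = clsGL L := by
  have h1 : L * L' = ContinuousMap.const 𝕊¹ 1 := by
    ext u : 1; exact Subtype.ext (h u)
  have h2 := clsGL_mul hn L L'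
  rw [h1, clsGL_const] at h2
  -- in `ZMod 2`, `a + b = 0` forces `a = b`
  have : ∀ a b : ZMod 2, 0 = a + b → b = a := by decide
  exact this _ _ h2

/-- Stabilisation of an invertible matrix. [folklore] -/
def NzMat.stab (A : NzMat n) : NzMat (n + 1) :=
  ⟨SOTransport.blockSucc A.1, by rw [SOTransport.det_blockSucc]; exact A.2⟩

/-- Stabilisation is continuous. [folklore] -/
theorem NzMat.continuous_stab : Continuous (NzMat.stab : NzMat n → NzMat (n + 1)) :=
  (SOTransport.continuous_blockSucc.comp continuous_val).subtype_mk _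

/-- Stabilisation of loops of invertible matrices. [folklore] -/
def stabGL (L : C(𝕊¹, NzMat n)) : C(𝕊¹, NzMat (n + 1)) :=
  ⟨fun u => NzMat.stab (L u), NzMat.continuous_stab.comp L.2⟩

/-- Values of `stabGL`. [folklore] -/
@[simp] theorem stabGL_apply_val (L : C(𝕊¹, NzMat n)) (u : 𝕊¹) : (stabGL L u).1 = SOTransport.blockSucc (L u).1 := rfl

/-- **Stabilisation does not change `clsGL`** (size `≥ 3`). [cite: HatcherAT2002, §4.2, Example 4.55] -/
theorem clsGL_stabGL (hn : 3 ≤ n + 1) (L : C(𝕊¹, NzMat (n + 1))) : clsGL (stabGL L) = clsGL L := by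
  by_cases h : 0 < (L u₀).1.det
  · have hs : 0 < (stabGL L u₀).1.det := by rw [stabGL_apply_val, SOTransport.det_blockSucc]; exact h
    rw [clsGL_eq_cls_of_pos _ hs (stabMap (toPos L)) fun u => by
      change SOTransport.blockSucc (toPos L u).1 = SOTransport.blockSucc (L u).1
      rw [toPos_of_pos L h]]
    unfold clsGL; exact cls_stabMap hn _
  · have hneg : (L u₀).1.det < 0 := lt_of_le_of_ne (not_lt.mp h) (L u₀).2
    have hs : (stabGL L u₀).1.det < 0 := by rw [stabGL_apply_val, SOTransport.det_blockSucc]; exact hneg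
    -- the constant `Q = P₀' (1 ⊕ P₀)` has determinant `1`
    let Q : PosMat (n + 1 + 1) := ⟨P0 (n + 1 + 1) * SOTransport.blockSucc (P0 (n + 1)), by
      rw [det_mul, det_P0, SOTransport.det_blockSucc, det_P0]; norm_num⟩
    have hQ : ∀ u, (toPos (stabGL L) u).1 = (Q * stabMap (toPos L) u).1 := fun u => by
      rw [toPos_of_neg _ hs]
      change P0 (n + 1 + 1) * SOTransport.blockSucc (L u).1 =
        P0 (n + 1 + 1) * SOTransport.blockSucc (P0 (n + 1)) * SOTransport.blockSucc (toPos L u).1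
      rw [toPos_of_neg L hneg, SOTransport.blockSucc_mul, Matrix.mul_assoc, ← Matrix.mul_assoc (SOTransport.blockSucc (P0 _)),
        ← SOTransport.blockSucc_mul, P0_mul_P0, SOTransport.blockSucc_one, Matrix.one_mul]
    unfold clsGL
    rw [cls_congr_val (L' := ContinuousMap.const 𝕊¹ Q * stabMap (toPos L)) hQ, cls_const_mul, cls_stabMap hn]

end GLClass

/-! ### 3. Frame fields along maps into a manifold: chart reading, comparison loops, actions -/

section Manifold

variable {m : ℕ} {M : Type*} [TopologicalSpace M] [ChartedSpace (𝔼 m) M] [IsManifold (𝓡 m) 1 M]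
  {X : Type*} [TopologicalSpace X]

/-- The map along which a frame field is defined is continuous on the region (projection of the
first section). [folklore] -/
theorem _root_.Literature.Topology.FourManifolds.IsStableFrameFieldOn.continuousOn_map {G : X → M} {F : X → Fr m}
    {R : Set X} (h : IsStableFrameFieldOn G F R) : ContinuousOn G R := by
  have h0 := h.1 0
  have hp : Continuous (Bundle.TotalSpace.proj : TangentBundle (𝓡 m) M → M) := FiberBundle.continuous_proj (𝔼 m) (TangentSpace (𝓡 m))
  exact (hp.comp_continuousOn h0)

/-- **Reading a frame in a chart**: apply the differential of the chart at `z` to the tangent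
components. [folklore] -/
def chartRead (z x : M) (F : Fr m) : Fr m := fun i => (mfderiv (𝓡 m) (𝓡 m) (chartAt (𝔼 m) z) x (F i).1, (F i).2)

/-- The chart reading as a linear automorphism of `ℝᵐ × ℝ` (at points of the chart domain).
[folklore] -/
def chartReadEquiv (z : M) {x : M} (hx : x ∈ (chartAt (𝔼 m) z).source) : ((𝔼 m) × ℝ) ≃ₗ[ℝ] ((𝔼 m) × ℝ) :=
  ((mdifferentiable_chart z : (chartAt (𝔼 m) z).MDifferentiable (𝓡 m) (𝓡 m)).mfderiv hx).toLinearEquiv.prodCongr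
    (LinearEquiv.refl ℝ ℝ)

/-- The chart reading is composition with `chartReadEquiv`. [folklore] -/
theorem chartRead_eq (z : M) {x : M} (hx : x ∈ (chartAt (𝔼 m) z).source) (F : Fr m) :
    chartRead z x F = (chartReadEquiv z hx) ∘ F := by
  funext i
  simp only [chartRead, chartReadEquiv, Function.comp_apply]
  rfl

/-- Chart readings of frames are frames. [folklore] -/
theorem linearIndependent_chartRead (z : M) {x : M} (hx : x ∈ (chartAt (𝔼 m) z).source) {F : Fr m}
    (hF : LinearIndependent ℝ F) : LinearIndependent ℝ (chartRead z x F) := by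
  rw [chartRead_eq z hx]
  exact hF.map' (chartReadEquiv z hx).toLinearMap (chartReadEquiv z hx).ker

/-- Comparison matrices can be computed in a chart. [folklore] -/
theorem compMat_chartRead (z : M) {x : M} (hx : x ∈ (chartAt (𝔼 m) z).source) {A B : Fr m} (hB : LinearIndependent ℝ B) :
    compMat (chartRead z x A) (chartRead z x B) = compMat A B := by
  rw [chartRead_eq z hx, chartRead_eq z hx]
  exact compMat_map (chartReadEquiv z hx) hB

/-- **A frame field read in a chart has continuous coordinates** on the part of the region mapped
into the chart domain (push-forward of continuous vector fields along the `C¹` chart). [folklore] -/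
theorem _root_.Literature.Topology.FourManifolds.IsStableFrameFieldOn.continuousOn_chartRead {G : X → M} {F : X → Fr m}
    {R : Set X} (h : IsStableFrameFieldOn G F R) (z : M) :
    ContinuousOn (fun q => chartRead z (G q) (F q)) (R ∩ G ⁻¹' (chartAt (𝔼 m) z).source) := by
  refine continuousOn_pi.mpr fun i => ?_
  refine ContinuousOn.prodMk ?_ ((h.2.1 i).mono inter_subset_left)
  have h1 : ContinuousOn (fun q => (TotalSpace.mk' (𝔼 m) (G q) (F q i).1 : TangentBundle (𝓡 m) M))
      (R ∩ G ⁻¹' (chartAt (𝔼 m) z).source) := (h.1 i).mono inter_subset_left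
  have h2 := ContinuousOn.totalSpaceMk_mfderiv (g := G) (chartAt (𝔼 m) z).open_source contMDiffOn_chart h1
    (fun q hq => hq.2)
  exact continuous_snd_tangentBundle_euclidean.comp_continuousOn h2

/-- **The comparison matrix of two frame fields along the same map varies continuously** on the
region. [folklore] -/
theorem continuousOn_compMat_frameField {G : X → M} {F₁ F₂ : X → Fr m} {R : Set X}
    (h₁ : IsStableFrameFieldOn G F₁ R) (h₂ : IsStableFrameFieldOn G F₂ R) :
    ContinuousOn (fun q => compMat (F₁ q) (F₂ q)) R := by
  intro q₀ hq₀
  set z := G q₀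
  set U := R ∩ G ⁻¹' (chartAt (𝔼 m) z).source
  have hU : G ⁻¹' (chartAt (𝔼 m) z).source ∈ 𝓝[R] q₀ :=
    (h₁.continuousOn_map q₀ hq₀).preimage_mem_nhdsWithin ((chartAt (𝔼 m) z).open_source.mem_nhds (mem_chart_source _ _))
  rw [← continuousWithinAt_inter' hU]
  have hc : ContinuousOn (fun q => compMat (chartRead z (G q) (F₁ q)) (chartRead z (G q) (F₂ q))) U :=
    continuousOn_compMat (h₁.continuousOn_chartRead z) (h₂.continuousOn_chartRead z)
      fun q hq => linearIndependent_chartRead z hq.2 (h₂.2.2 q hq.1)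
  have heq : ∀ q ∈ U, compMat (chartRead z (G q) (F₁ q)) (chartRead z (G q) (F₂ q)) = compMat (F₁ q) (F₂ q) :=
    fun q hq => compMat_chartRead z hq.2 (h₂.2.2 q hq.1)
  exact ((hc.congr fun q hq => (heq q hq).symm) q₀ ⟨hq₀, mem_chart_source _ _⟩)

/-- **The comparison loop** of two frame fields along the same circle map, as a loop of invertible
matrices. [folklore] -/
def compLoopGL {c : 𝕊¹ → M} (F₁ F₂ : 𝕊¹ → Fr m) (h₁ : IsStableFrameFieldOn c F₁ univ) (h₂ : IsStableFrameFieldOn c F₂ univ) :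
    C(𝕊¹, NzMat (m + 1)) :=
  ⟨fun u => ⟨compMat (F₁ u) (F₂ u), det_compMat_ne_zero (h₁.2.2 u (mem_univ u)) (h₂.2.2 u (mem_univ u))⟩,
    (continuousOn_univ.mp (continuousOn_compMat_frameField h₁ h₂)).subtype_mk _⟩

/-- Values of the comparison loop. [folklore] -/
@[simp] theorem compLoopGL_apply_val {c : 𝕊¹ → M} (F₁ F₂ : 𝕊¹ → Fr m) (h₁ : IsStableFrameFieldOn c F₁ univ)
    (h₂ : IsStableFrameFieldOn c F₂ univ) (u : 𝕊¹) : (compLoopGL F₁ F₂ h₁ h₂ u).1 = compMat (F₁ u) (F₂ u) := rfl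

/-! ### The right action of continuous matrix families on frame fields -/

/-- **A frame field acted on by a continuous family of invertible matrices is a frame field**
(fibrewise linear combinations of continuous sections along a map are continuous: read in a
chart, combine, read back). [folklore] -/
theorem _root_.Literature.Topology.FourManifolds.IsStableFrameFieldOn.act {G : X → M} {F : X → Fr m} {R : Set X}
    (h : IsStableFrameFieldOn G F R) {C : X → Matrix (Fin (m + 1)) (Fin (m + 1)) ℝ} (hC : ContinuousOn C R)
    (hdet : ∀ q ∈ R, (C q).det ≠ 0) : IsStableFrameFieldOn G (fun q => StableFrames.act (F q) (C q)) R := by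
  refine ⟨fun j => ?_, fun j => ?_, fun q hq => linearIndependent_act (h.2.2 q hq) (hdet q hq)⟩
  · -- tangent components: local statement in charts
    intro q₀ hq₀
    set z := G q₀
    set U := R ∩ G ⁻¹' (chartAt (𝔼 m) z).source
    have hG := h.continuousOn_map
    have hU : G ⁻¹' (chartAt (𝔼 m) z).source ∈ 𝓝[R] q₀ :=
      (hG q₀ hq₀).preimage_mem_nhdsWithin ((chartAt (𝔼 m) z).open_source.mem_nhds (mem_chart_source _ _))
    rw [← continuousWithinAt_inter' hU]
    set φ := chartAt (𝔼 m) z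
    have hφd : φ.MDifferentiable (𝓡 m) (𝓡 m) := mdifferentiable_chart z
    -- the chart coordinates of the combination, continuous on `U`
    have hread := h.continuousOn_chartRead z
    have ha : ContinuousOn (fun q => ∑ i, C q i j • (mfderiv (𝓡 m) (𝓡 m) φ (G q) (F q i).1)) U := by
      refine continuousOn_finsetSum _ fun i _ => ?_
      have hCij : ContinuousOn (fun q => C q i j) U :=
        ((continuous_id (X := Matrix (Fin (m + 1)) (Fin (m + 1)) ℝ)).matrix_elem i j).comp_continuousOn (hC.mono inter_subset_left)
      exact hCij.smul (continuous_fst.comp_continuousOn ((continuousOn_pi.mp hread) i))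
    have hlin : ∀ q, mfderiv (𝓡 m) (𝓡 m) φ (G q) (∑ i, C q i j • (F q i).1) =
        ∑ i, C q i j • mfderiv (𝓡 m) (𝓡 m) φ (G q) (F q i).1 := fun q => by
      rw [map_sum]
      exact Finset.sum_congr rfl fun i _ => (mfderiv (𝓡 m) (𝓡 m) φ (G q)).map_smul (C q i j) (F q i).1
    -- read back along `φ.symm`
    have hin : ContinuousOn (fun q => (TotalSpace.mk' (𝔼 m) (φ (G q))
        (∑ i, C q i j • mfderiv (𝓡 m) (𝓡 m) φ (G q) (F q i).1) : TangentBundle (𝓡 m) (𝔼 m))) U :=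
      ContinuousOn.totalSpaceMk_euclidean (φ.continuousOn.comp (hG.mono inter_subset_left) fun q hq => hq.2) ha
    have hback := ContinuousOn.totalSpaceMk_mfderiv (g := φ ∘ G) φ.open_target contMDiffOn_chart_symm hin
      (fun q hq => φ.map_source hq.2)
    refine (hback.congr fun q hq => ?_) q₀ ⟨hq₀, mem_chart_source _ _⟩
    have hfst : (StableFrames.act (F q) (C q) j).1 = ∑ i, C q i j • (F q i).1 := by
      simp only [StableFrames.act, Prod.fst_sum, Prod.smul_fst]
    change (TotalSpace.mk' (𝔼 m) (G q) (StableFrames.act (F q) (C q) j).1 : TangentBundle (𝓡 m) M) =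
      TotalSpace.mk' (𝔼 m) (φ.symm (φ (G q))) (mfderiv (𝓡 m) (𝓡 m) φ.symm (φ (G q)) _)
    rw [hfst, ← hlin, show mfderiv (𝓡 m) (𝓡 m) φ.symm (φ (G q)) (mfderiv (𝓡 m) (𝓡 m) φ (G q) (∑ i, C q i j • (F q i).1))
      = ∑ i, C q i j • (F q i).1 from DFunLike.congr_fun (hφd.symm_comp_deriv hq.2) _]
    congr 1
    exact (φ.left_inv hq.2).symm
  · -- real components
    have : (fun q => (StableFrames.act (F q) (C q) j).2) = fun q => ∑ i, C q i j * (F q i).2 := by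
      funext q; simp only [StableFrames.act, Prod.snd_sum, Prod.smul_snd, smul_eq_mul]
    rw [this]
    refine continuousOn_finsetSum _ fun i _ => ?_
    have hCij : ContinuousOn (fun q => C q i j) R :=
      ((continuous_id (X := Matrix (Fin (m + 1)) (Fin (m + 1)) ℝ)).matrix_elem i j).comp_continuousOn hC
    exact hCij.mul (h.2.1 i)

end Manifold

/-! ### 4. Discs: the extension class `e(F, D)` -/

section Disc

variable {m : ℕ} {M : Type*} [TopologicalSpace M] [ChartedSpace (𝔼 m) M] [IsManifold (𝓡 m) 1 M]

/-- **The closed unit disc** in the plane, as a type. [folklore] -/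
abbrev UnitDisc2 : Type := ↥(closedBall (0 : EuclideanSpace ℝ (Fin (1 + 1))) 1)

/-- Local notation: the closed unit disc in the plane. -/
local notation "𝔻²" => UnitDisc2

/-- The closed unit disc is compact. [folklore] -/
instance : CompactSpace 𝔻² := isCompact_iff_compactSpace.mp (isCompact_closedBall _ _)

/-- The boundary circle of the disc. [folklore] -/
def bd (u : 𝕊¹) : 𝔻² := ⟨u.1, sphere_subset_closedBall u.2⟩

/-- The boundary inclusion is continuous. [folklore] -/
theorem continuous_bd : Continuous bd := continuous_subtype_val.subtype_mk _

/-- The boundary inclusion, on points. [folklore] -/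
@[simp] theorem bd_val (u : 𝕊¹) : (bd u).1 = u.1 := rfl

/-- The centre of the disc. [folklore] -/
def ctr : 𝔻² := ⟨0, by simp⟩

/-- **A frame field agreeing in the map**: the frame-field property only depends on the values of
the map on the region. [folklore] -/
theorem _root_.Literature.Topology.FourManifolds.IsStableFrameFieldOn.congr_map {X : Type*} [TopologicalSpace X]
    {G G' : X → M} {F : X → Fr m} {R : Set X} (h : IsStableFrameFieldOn G F R) (hG : ∀ q ∈ R, G' q = G q) :
    IsStableFrameFieldOn G' F R := by
  refine ⟨fun i => (h.1 i).congr fun q hq => ?_, h.2.1, h.2.2⟩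
  rw [hG q hq]

/-- **Every disc map carries a stable frame field** (the disc is contractible; covering homotopy
theorem for stable framings, tree's `HasStableTangentFramingAlong.of_homotopic_const`). [folklore] -/
theorem exists_discFrame (D : C(𝔻², M)) : ∃ G : 𝔻² → Fr m, IsStableFrameFieldOn D G univ := by
  have hh : D.Homotopic (ContinuousMap.const 𝔻² (D ctr)) := by
    refine ⟨{ toFun := fun p => D ⟨(1 - (p.1 : ℝ)) • (p.2 : EuclideanSpace ℝ (Fin (1 + 1))), ?_⟩,
              continuous_toFun := ?_,
              map_zero_left := fun x => ?_,
              map_one_left := fun x => ?_ }⟩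
    · have hx := p.2.2
      rw [mem_closedBall, dist_zero_right] at hx ⊢
      rw [norm_smul, Real.norm_eq_abs, abs_of_nonneg (by linarith [p.1.2.2])]
      nlinarith [p.1.2.1, p.1.2.2, norm_nonneg (p.2 : EuclideanSpace ℝ (Fin (1 + 1)))]
    · exact D.continuous.comp (((continuous_const.sub (continuous_subtype_val.comp continuous_fst)).smul
        (continuous_subtype_val.comp continuous_snd)).subtype_mk _)
    · change D _ = D x; congr 1; apply Subtype.ext; simp
    · change D _ = D ctr; congr 1; apply Subtype.ext; simp [ctr]
  exact (HasStableTangentFramingAlong.of_homotopic_const hh).exists_isStableFrameFieldOn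

/-- A chosen stable frame field along a disc map. [folklore] -/
def discFrame (D : C(𝔻², M)) : 𝔻² → Fr m := Classical.choose (exists_discFrame D)

/-- The chosen disc frame is a frame field. [folklore] -/
theorem discFrame_spec (D : C(𝔻², M)) : IsStableFrameFieldOn D (discFrame D : 𝔻² → Fr m) univ :=
  Classical.choose_spec (exists_discFrame D)

/-- Restriction of a disc frame field to the boundary circle. [folklore] -/
theorem _root_.Literature.Topology.FourManifolds.IsStableFrameFieldOn.bd {D : 𝔻² → M} {G : 𝔻² → Fr m}
    (h : IsStableFrameFieldOn D G univ) : IsStableFrameFieldOn (D ∘ bd) (G ∘ bd) univ :=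
  h.comp continuous_bd.continuousOn (mapsTo_univ _ _)

/-- **The extension class `e(F, D) ∈ ℤ/2`** of a stable frame `F` along the boundary circle of a
disc map `D`: the class of the loop comparing `F` with (the restriction of) a frame field over the
disc. It vanishes iff `F` extends over the disc; it does not depend on the disc frame used
(`eClass_eq`). [cite: Kirby1989, Ch. IV p. 33 (trivialisations over the 2-skeleton)] -/
def eClass (D : C(𝔻², M)) (F : 𝕊¹ → Fr m) (hF : IsStableFrameFieldOn (D ∘ bd) F univ) : ZMod 2 :=
  clsGL (compLoopGL F ((discFrame D : 𝔻² → Fr m) ∘ bd) hF (discFrame_spec D).bd)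

/-- The comparison loop of two disc frames extends over the disc. [folklore] -/
theorem clsGL_compLoopGL_bd_eq_zero {D : C(𝔻², M)} {G G' : 𝔻² → Fr m} (hG : IsStableFrameFieldOn D G univ)
    (hG' : IsStableFrameFieldOn D G' univ) : clsGL (compLoopGL (G ∘ bd) (G' ∘ bd) hG.bd hG'.bd) = 0 := by
  refine clsGL_eq_zero_of_extends _ ⟨fun x => ⟨compMat (G x) (G' x),
    det_compMat_ne_zero (hG.2.2 x (mem_univ x)) (hG'.2.2 x (mem_univ x))⟩,
    (continuousOn_univ.mp (continuousOn_compMat_frameField hG hG')).subtype_mk _⟩ fun u => rfl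

/-- Products of comparison loops. [folklore] -/
theorem compLoopGL_mul {c : 𝕊¹ → M} {F₁ F₂ F₃ : 𝕊¹ → Fr m} (h₁ : IsStableFrameFieldOn c F₁ univ)
    (h₂ : IsStableFrameFieldOn c F₂ univ) (h₃ : IsStableFrameFieldOn c F₃ univ) :
    compLoopGL F₂ F₃ h₂ h₃ * compLoopGL F₁ F₂ h₁ h₂ = compLoopGL F₁ F₃ h₁ h₃ := by
  ext u : 1; apply Subtype.ext
  exact compMat_mul_compMat (h₂.2.2 u (mem_univ u)) (h₃.2.2 u (mem_univ u))

/-- **`e(F, D)` is independent of the disc frame**: it may be computed with any stable frame field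
along `D`. [folklore] -/
theorem eClass_eq (hm : 2 ≤ m) {D : C(𝔻², M)} {F : 𝕊¹ → Fr m} (hF : IsStableFrameFieldOn (D ∘ bd) F univ)
    {G : 𝔻² → Fr m} (hG : IsStableFrameFieldOn D G univ) :
    eClass D F hF = clsGL (compLoopGL F (G ∘ bd) hF hG.bd) := by
  unfold eClass
  rw [← compLoopGL_mul (F₂ := (discFrame D : 𝔻² → Fr m) ∘ bd) hF (discFrame_spec D).bd hG.bd, clsGL_mul (by omega),
    clsGL_compLoopGL_bd_eq_zero (discFrame_spec D) hG, zero_add]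

/-- **`e(F, D) = 0` when `F` is the boundary restriction of a frame field over the disc.**
[folklore] -/
theorem eClass_bd (hm : 2 ≤ m) {D : C(𝔻², M)} {G : 𝔻² → Fr m} (hG : IsStableFrameFieldOn D G univ) :
    eClass D (G ∘ bd) hG.bd = 0 := by
  rw [eClass_eq hm hG.bd hG]
  have : compLoopGL (G ∘ bd) (G ∘ bd) hG.bd hG.bd = ContinuousMap.const 𝕊¹ 1 := by
    ext u : 1; apply Subtype.ext
    exact compMat_self (hG.2.2 _ (mem_univ _))
  rw [this]; exact clsGL_const _

/-- The class does not depend on the proof of the frame-field property, nor on the frame beyond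
its values. [folklore] -/
theorem eClass_congr {D : C(𝔻², M)} {F F' : 𝕊¹ → Fr m} (hF : IsStableFrameFieldOn (D ∘ bd) F univ)
    (hF' : IsStableFrameFieldOn (D ∘ bd) F' univ) (h : ∀ u, F u = F' u) : eClass D F hF = eClass D F' hF' := by
  have : F = F' := funext h
  subst this; rfl

/-- **The right action changes `e(F, D)` by the class of the acting loop**:
`e(F · C, D) = e(F, D) + clsGL C`. [cite: GompfStipsiczGSM1999, §5.2] -/
theorem eClass_act (hm : 2 ≤ m) {D : C(𝔻², M)} {F : 𝕊¹ → Fr m} (hF : IsStableFrameFieldOn (D ∘ bd) F univ)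
    (C : C(𝕊¹, NzMat (m + 1))) :
    eClass D (fun u => act (F u) (C u).1)
      (hF.act (NzMat.continuous_val.comp C.2).continuousOn fun u _ => (C u).2) = eClass D F hF + clsGL C := by
  unfold eClass
  rw [← clsGL_mul (by omega)]
  congr 1
  ext u : 1; apply Subtype.ext
  exact compMat_act ((discFrame_spec D).bd.2.2 u (mem_univ u)) (C u).1

end Disc

/-! ### 5. Transport of frames: push-forward along a local diffeomorphism, lift to one dimension more -/

section Push

variable {m : ℕ} {M : Type*} [TopologicalSpace M] [ChartedSpace (𝔼 m) M]
  {M' : Type*} [TopologicalSpace M'] [ChartedSpace (𝔼 m) M']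
  {X : Type*} [TopologicalSpace X]

/-- Local notation: the closed unit disc in the plane. -/
local notation "𝔻²" => UnitDisc2

/-- **Push-forward of a frame** along a map `φ` (differential on tangent components). [folklore] -/
def pushFr (φ : M → M') (x : M) (F : Fr m) : Fr m := fun i => (mfderiv (𝓡 m) (𝓡 m) φ x (F i).1, (F i).2)

/-- The push-forward as a linear map of `ℝᵐ × ℝ`. [folklore] -/
def pushLin (φ : M → M') (x : M) : ((𝔼 m) × ℝ) →ₗ[ℝ] ((𝔼 m) × ℝ) :=
  (mfderiv (𝓡 m) (𝓡 m) φ x).toLinearMap.prodMap LinearMap.id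

/-- The push-forward is composition with `pushLin`. [folklore] -/
theorem pushFr_eq (φ : M → M') (x : M) (F : Fr m) : pushFr φ x F = (pushLin φ x) ∘ F := by
  funext i; rfl

/-- `pushLin` is injective when the differential is. [folklore] -/
theorem injective_pushLin {φ : M → M'} {x : M} (h : Injective (mfderiv (𝓡 m) (𝓡 m) φ x)) :
    Injective (pushLin φ x : ((𝔼 m) × ℝ) →ₗ[ℝ] ((𝔼 m) × ℝ)) := by
  intro a b hab
  have h1 := congrArg Prod.fst hab
  have h2 := congrArg Prod.snd hab
  exact Prod.ext (h h1) h2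

/-- The push-forward along an injective differential, as a linear automorphism of `ℝᵐ × ℝ`
(injective endomorphisms of a finite-dimensional space are automorphisms). [folklore] -/
def pushEquiv {φ : M → M'} {x : M} (h : Injective (mfderiv (𝓡 m) (𝓡 m) φ x)) : ((𝔼 m) × ℝ) ≃ₗ[ℝ] ((𝔼 m) × ℝ) :=
  LinearMap.linearEquivOfInjective (pushLin φ x : ((𝔼 m) × ℝ) →ₗ[ℝ] ((𝔼 m) × ℝ)) (injective_pushLin h) rfl

/-- Comparison matrices are preserved by push-forward along an injective differential. [folklore] -/
theorem compMat_pushFr {φ : M → M'} {x : M} (h : Injective (mfderiv (𝓡 m) (𝓡 m) φ x)) {A B : Fr m}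
    (hB : LinearIndependent ℝ B) : compMat (pushFr φ x A) (pushFr φ x B) = compMat A B := by
  rw [pushFr_eq, pushFr_eq]
  exact compMat_map (pushEquiv h) hB

variable [IsManifold (𝓡 m) 1 M] [IsManifold (𝓡 m) 1 M']

/-- **Push-forward of a frame field along a `C¹` map with injective differential is a frame field**
along the composite. [folklore] -/
theorem _root_.Literature.Topology.FourManifolds.IsStableFrameFieldOn.push {φ : M → M'} (hφ : ContMDiff (𝓡 m) (𝓡 m) 1 φ)
    (hinj : ∀ x, Injective (mfderiv (𝓡 m) (𝓡 m) φ x)) {G : X → M} {F : X → Fr m} {R : Set X}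
    (h : IsStableFrameFieldOn G F R) : IsStableFrameFieldOn (φ ∘ G) (fun q => pushFr φ (G q) (F q)) R := by
  refine ⟨fun i => ?_, fun i => h.2.1 i, fun q hq => ?_⟩
  · exact ContinuousOn.totalSpaceMk_mfderiv (g := G) isOpen_univ hφ.contMDiffOn (h.1 i) (mapsTo_univ _ _)
  · change LinearIndependent ℝ (pushFr φ (G q) (F q))
    rw [pushFr_eq]
    exact (h.2.2 q hq).map' _ (LinearMap.ker_eq_bot.mpr (injective_pushLin (hinj (G q))))

/-- Composition of a disc map with a continuous map. [folklore] -/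
def compDisc (φ : C(M, M')) (D : C(𝔻², M)) : C(𝔻², M') := φ.comp D

/-- **`e(F, D)` is preserved by push-forward** along a `C¹` map with injective differential
(in particular by diffeomorphisms and open embeddings). [folklore] -/
theorem eClass_push (hm : 2 ≤ m) {φ : M → M'} (hφ : ContMDiff (𝓡 m) (𝓡 m) 1 φ)
    (hinj : ∀ x, Injective (mfderiv (𝓡 m) (𝓡 m) φ x)) {D : C(𝔻², M)} {F : 𝕊¹ → Fr m}
    (hF : IsStableFrameFieldOn (D ∘ bd) F univ) :
    eClass (compDisc ⟨φ, hφ.continuous⟩ D) (fun u => pushFr φ (D (bd u)) (F u)) (hF.push hφ hinj) = eClass D F hF := by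
  have hG := (discFrame_spec D).push hφ hinj
  rw [eClass_eq hm (hF.push hφ hinj) (G := fun x => pushFr φ (D x) (discFrame D x)) hG]
  unfold eClass
  congr 1
  ext u : 1; apply Subtype.ext
  exact compMat_pushFr (hinj _) ((discFrame_spec D).2.2 _ (mem_univ _))

end Push

section Lift

variable {k : ℕ} {V : Type*} [TopologicalSpace V] [ChartedSpace (𝔼 k) V] [IsManifold (𝓡 k) 1 V]
  {Y : Type*} [TopologicalSpace Y] [ChartedSpace (𝔼 (k + 1)) Y] [IsManifold (𝓡 (k + 1)) 1 Y]
  {X : Type*} [TopologicalSpace X]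

/-- Local notation: the closed unit disc in the plane. -/
local notation "𝔻²" => UnitDisc2

/-- **Lift of a frame to one dimension more**: prepend a vector `w` (the transverse direction) and
apply a linear map `T` (the differential of the embedding) to the tangent components. [folklore] -/
def liftFr (T : (𝔼 k) →ₗ[ℝ] (𝔼 (k + 1))) (w : 𝔼 (k + 1)) (F : Fr k) : Fr (k + 1) :=
  Fin.cons (w, 0) fun i => (T (F i).1, (F i).2)

/-- The first vector of a lift is the prepended one. [folklore] -/
@[simp] theorem liftFr_zero (T : (𝔼 k) →ₗ[ℝ] (𝔼 (k + 1))) (w : 𝔼 (k + 1)) (F : Fr k) : liftFr T w F 0 = (w, 0) := by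
  simp [liftFr]

/-- The later vectors of a lift are the images of the frame vectors. [folklore] -/
@[simp] theorem liftFr_succ (T : (𝔼 k) →ₗ[ℝ] (𝔼 (k + 1))) (w : 𝔼 (k + 1)) (F : Fr k) (i : Fin (k + 1)) :
    liftFr T w F i.succ = (T (F i).1, (F i).2) := by
  simp [liftFr]

/-- The linear part of the lift. [folklore] -/
def liftLin (T : (𝔼 k) →ₗ[ℝ] (𝔼 (k + 1))) : ((𝔼 k) × ℝ) →ₗ[ℝ] ((𝔼 (k + 1)) × ℝ) := T.prodMap LinearMap.id

/-- **Lifts of frames are frames** when `T` is injective and `w ∉ range T`. [folklore] -/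
theorem linearIndependent_liftFr {T : (𝔼 k) →ₗ[ℝ] (𝔼 (k + 1))} (hT : Injective T) {w : 𝔼 (k + 1)}
    (hw : w ∉ LinearMap.range T) {F : Fr k} (hF : LinearIndependent ℝ F) : LinearIndependent ℝ (liftFr T w F) := by
  have hinj : Injective (liftLin T) := fun a b hab => by
    have h1 := congrArg Prod.fst hab
    have h2 := congrArg Prod.snd hab
    exact Prod.ext (hT h1) h2
  have h1 : LinearIndependent ℝ (fun i : Fin (k + 1) => ((T (F i).1, (F i).2) : (𝔼 (k + 1)) × ℝ)) := by
    have : (fun i : Fin (k + 1) => ((T (F i).1, (F i).2) : (𝔼 (k + 1)) × ℝ)) = (liftLin T) ∘ F := by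
      funext i; rfl
    rw [this]
    exact hF.map' _ (LinearMap.ker_eq_bot.mpr hinj)
  change LinearIndependent ℝ (Fin.cons ((w, (0 : ℝ)) : (𝔼 (k + 1)) × ℝ) fun i => (T (F i).1, (F i).2))
  rw [linearIndependent_finCons]
  refine ⟨h1, fun hmem => hw ?_⟩
  rw [Submodule.mem_span_range_iff_exists_fun] at hmem
  obtain ⟨c, hc⟩ := hmem
  have h0 := congrArg Prod.fst hc
  simp only [Prod.fst_sum, Prod.smul_fst] at h0
  refine ⟨∑ i, c i • (F i).1, ?_⟩
  rw [map_sum]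
  rw [← h0]
  exact Finset.sum_congr rfl fun i _ => T.map_smul (c i) (F i).1

/-- Comparison matrices of lifts are stabilised comparison matrices. [folklore] -/
theorem compMat_liftFr {T : (𝔼 k) →ₗ[ℝ] (𝔼 (k + 1))} (hT : Injective T) {w : 𝔼 (k + 1)}
    (hw : w ∉ LinearMap.range T) {A B : Fr k} (hB : LinearIndependent ℝ B) :
    compMat (liftFr T w A) (liftFr T w B) = SOTransport.blockSucc (compMat A B) := by
  have hlB := linearIndependent_liftFr hT hw hB
  -- `lift A = lift B · blockSucc (compMat A B)`
  have key : liftFr T w A = act (liftFr T w B) (SOTransport.blockSucc (compMat A B)) := by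
    funext j
    change liftFr T w A j = ∑ i, SOTransport.blockSucc (compMat A B) i j • liftFr T w B i
    rw [Fin.sum_univ_succ]
    refine Fin.cases ?_ (fun j' => ?_) j
    · simp [SOTransport.blockSucc_zero_zero, SOTransport.blockSucc_succ_zero]
    · simp only [liftFr_zero, liftFr_succ, SOTransport.blockSucc_zero_succ, zero_smul, zero_add,
        SOTransport.blockSucc_succ_succ]
      have hA := sum_compMat_smul (A := A) hB j'
      apply Prod.ext
      · simp only [Prod.fst_sum, Prod.smul_fst]
        rw [← hA, Prod.fst_sum, map_sum]
        exact Finset.sum_congr rfl fun i _ => by rw [Prod.smul_fst, T.map_smul]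
      · simp only [Prod.snd_sum, Prod.smul_snd, smul_eq_mul]
        rw [← hA]
        simp only [Prod.snd_sum, Prod.smul_snd, smul_eq_mul]
  conv_lhs => rw [key]
  exact compMat_act_self hlB _

variable (ι : V → Y) (ξ : V → 𝔼 (k + 1))

/-- The lifted frame field along a level-type embedding `ι : V → Y` with transverse field `ξ`.
[folklore] -/
def liftField {G : X → V} (F : X → Fr k) (q : X) : Fr (k + 1) :=
  liftFr (mfderiv (𝓡 k) (𝓡 (k + 1)) ι (G q)).toLinearMap (ξ (G q)) (F q)

/-- **The lift of a frame field along `G` is a frame field along `ι ∘ G`**, for `ι` a `C¹` map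
with injective differential and `ξ` a continuous vector field along `ι` nowhere tangent to `ι(V)`
(for a regular level of a Morse function: the inclusion and the gradient-like field). [folklore] -/
theorem _root_.Literature.Topology.FourManifolds.IsStableFrameFieldOn.lift (hι : ContMDiff (𝓡 k) (𝓡 (k + 1)) 1 ι)
    (hinj : ∀ x, Injective (mfderiv (𝓡 k) (𝓡 (k + 1)) ι x))
    (hξ : Continuous fun x => (TotalSpace.mk' (𝔼 (k + 1)) (ι x) (ξ x) : TangentBundle (𝓡 (k + 1)) Y))
    (hξt : ∀ x, ξ x ∉ LinearMap.range (mfderiv (𝓡 k) (𝓡 (k + 1)) ι x).toLinearMap)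
    {G : X → V} {F : X → Fr k} {R : Set X} (h : IsStableFrameFieldOn G F R) :
    IsStableFrameFieldOn (ι ∘ G) (liftField ι ξ (G := G) F) R := by
  refine ⟨fun i => ?_, fun i => ?_, fun q hq => ?_⟩
  · refine Fin.cases ?_ (fun j => ?_) i
    · have : (fun q => (TotalSpace.mk' (𝔼 (k + 1)) ((ι ∘ G) q) (liftField ι ξ (G := G) F q 0).1 : TangentBundle (𝓡 (k + 1)) Y))
          = (fun x => (TotalSpace.mk' (𝔼 (k + 1)) (ι x) (ξ x) : TangentBundle (𝓡 (k + 1)) Y)) ∘ G := by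
        funext q; simp [liftField]
      rw [this]
      exact hξ.comp_continuousOn h.continuousOn_map
    · have : (fun q => (TotalSpace.mk' (𝔼 (k + 1)) ((ι ∘ G) q) (liftField ι ξ (G := G) F q j.succ).1 : TangentBundle (𝓡 (k + 1)) Y))
          = fun q => (TotalSpace.mk' (𝔼 (k + 1)) (ι (G q)) (mfderiv (𝓡 k) (𝓡 (k + 1)) ι (G q) (F q j).1) :
            TangentBundle (𝓡 (k + 1)) Y) := by
        funext q; simp only [liftField, liftFr_succ, Function.comp_apply]; rfl
      rw [this]
      exact ContinuousOn.totalSpaceMk_mfderiv (g := G) isOpen_univ hι.contMDiffOn (h.1 j) (mapsTo_univ _ _)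
  · refine Fin.cases ?_ (fun j => ?_) i
    · simp only [liftField, liftFr_zero]; exact continuousOn_const
    · simp only [liftField, liftFr_succ]; exact h.2.1 j
  · exact linearIndependent_liftFr (hinj (G q)) (hξt (G q)) (h.2.2 q hq)

/-- **`e(F, D)` is preserved by the lift**: the class computed in `Y` along `ι ∘ D` of the lifted
frame equals the class computed in `V` (stability of the class under `A ↦ 1 ⊕ A`). [folklore] -/
theorem eClass_lift (hk : 2 ≤ k) (hι : ContMDiff (𝓡 k) (𝓡 (k + 1)) 1 ι)
    (hinj : ∀ x, Injective (mfderiv (𝓡 k) (𝓡 (k + 1)) ι x))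
    (hξ : Continuous fun x => (TotalSpace.mk' (𝔼 (k + 1)) (ι x) (ξ x) : TangentBundle (𝓡 (k + 1)) Y))
    (hξt : ∀ x, ξ x ∉ LinearMap.range (mfderiv (𝓡 k) (𝓡 (k + 1)) ι x).toLinearMap)
    {D : C(𝔻², V)} {F : 𝕊¹ → Fr k} (hF : IsStableFrameFieldOn (D ∘ bd) F univ) :
    eClass (⟨ι ∘ D, hι.continuous.comp D.2⟩ : C(𝔻², Y)) (liftField ι ξ (G := D ∘ bd) F) (hF.lift ι ξ hι hinj hξ hξt) =
      eClass D F hF := by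
  have hG := (discFrame_spec D).lift ι ξ hι hinj hξ hξt
  rw [eClass_eq (by omega) (hF.lift ι ξ hι hinj hξ hξt) (G := liftField ι ξ (G := D) (discFrame D)) hG]
  unfold eClass
  rw [← clsGL_stabGL (by omega) (compLoopGL F ((discFrame D : 𝔻² → Fr k) ∘ bd) hF (discFrame_spec D).bd)]
  refine congrArg clsGL ?_
  ext u : 1; apply Subtype.ext
  exact compMat_liftFr (hinj _) (hξt _) ((discFrame_spec D).2.2 _ (mem_univ _))

end Lift

/-! ### 6. Spheres from two discs: the obstruction `κ` and the extension classes -/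

section Sphere

variable {m : ℕ} {M : Type*} [TopologicalSpace M] [ChartedSpace (𝔼 m) M]

/-- Local notation: the closed unit disc in the plane. -/
local notation "𝔻²" => UnitDisc2

/-- Local notation: the unit `2`-sphere. -/
local notation "𝕊²" => (sphere (0 : EuclideanSpace ℝ (Fin (2 + 1))) 1)

/-- Squared norm of a point of the plane. [folklore] -/
theorem norm_sq_two (x : EuclideanSpace ℝ (Fin (1 + 1))) : ‖x‖ ^ 2 = x 0 ^ 2 + x 1 ^ 2 := by
  rw [EuclideanSpace.norm_sq_eq, Fin.sum_univ_two]; simp [sq_abs]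

/-- Squared norm of a point of space. [folklore] -/
theorem norm_sq_three (p : EuclideanSpace ℝ (Fin (2 + 1))) : ‖p‖ ^ 2 = p 0 ^ 2 + p 1 ^ 2 + p 2 ^ 2 := by
  rw [EuclideanSpace.norm_sq_eq, Fin.sum_univ_three]; simp [sq_abs]

/-- A point of the sphere has `p₀² + p₁² + p₂² = 1`. [folklore] -/
theorem sphere_eq (p : 𝕊²) : p.1 0 ^ 2 + p.1 1 ^ 2 + p.1 2 ^ 2 = 1 := by
  rw [← norm_sq_three, norm_eq_of_mem_sphere p]; norm_num

/-- A point of the circle has `u₀² + u₁² = 1`. [folklore] -/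
theorem circle_eq (u : 𝕊¹) : u.1 0 ^ 2 + u.1 1 ^ 2 = 1 := by
  rw [← norm_sq_two, norm_eq_of_mem_sphere u]; norm_num

/-- A vector with `v₀² + v₁² + v₂² = 1` lies on the sphere. [folklore] -/
theorem mem_sphere_of_sq (v : EuclideanSpace ℝ (Fin (2 + 1))) (h : v 0 ^ 2 + v 1 ^ 2 + v 2 ^ 2 = 1) : v ∈ 𝕊² := by
  rw [mem_sphere_zero_iff_norm]
  have h2 : ‖v‖ ^ 2 = 1 := by rw [norm_sq_three]; exact h
  exact (pow_eq_one_iff_of_nonneg (norm_nonneg v) two_ne_zero).mp h2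

/-- A vector of the plane with `x₀² + x₁² ≤ 1` lies in the disc. [folklore] -/
theorem mem_disc_of_sq (x : EuclideanSpace ℝ (Fin (1 + 1))) (h : x 0 ^ 2 + x 1 ^ 2 ≤ 1) :
    x ∈ closedBall (0 : EuclideanSpace ℝ (Fin (1 + 1))) 1 := by
  rw [mem_closedBall, dist_zero_right]
  have h2 : ‖x‖ ^ 2 ≤ 1 := by rw [norm_sq_two]; exact h
  nlinarith [norm_nonneg x]

/-- **Vertical projection** of the sphere onto the disc. [folklore] -/
def projD (p : 𝕊²) : 𝔻² :=
  ⟨!₂[p.1 0, p.1 1], mem_disc_of_sq _ (by have := sphere_eq p; simp; nlinarith [sq_nonneg (p.1 2)])⟩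

/-- Coordinates of the projection. [folklore] -/
@[simp] theorem projD_apply_zero (p : 𝕊²) : (projD p).1 0 = p.1 0 := by simp [projD]

/-- Coordinates of the projection. [folklore] -/
@[simp] theorem projD_apply_one (p : 𝕊²) : (projD p).1 1 = p.1 1 := by simp [projD]

/-- Continuity into `EuclideanSpace ℝ (Fin 2)` from continuity of the two coordinates. [folklore] -/
theorem continuous_vec2 {Z : Type*} [TopologicalSpace Z] {a b : Z → ℝ} (ha : Continuous a) (hb : Continuous b) :
    Continuous fun z => (!₂[a z, b z] : EuclideanSpace ℝ (Fin (1 + 1))) :=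
  (PiLp.continuous_toLp 2 _).comp (ha.finCons (hb.finCons continuous_const))

/-- Continuity into `EuclideanSpace ℝ (Fin 3)` from continuity of the three coordinates. [folklore] -/
theorem continuous_vec3 {Z : Type*} [TopologicalSpace Z] {a b c : Z → ℝ} (ha : Continuous a) (hb : Continuous b)
    (hc : Continuous c) : Continuous fun z => (!₂[a z, b z, c z] : EuclideanSpace ℝ (Fin (2 + 1))) :=
  (PiLp.continuous_toLp 2 _).comp (ha.finCons (hb.finCons (hc.finCons continuous_const)))

/-- Coordinates of points of the sphere are continuous. [folklore] -/
theorem continuous_sphere_coord (i : Fin (2 + 1)) : Continuous fun p : 𝕊² => p.1 i :=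
  (PiLp.continuous_apply 2 _ i).comp continuous_subtype_val

/-- Coordinates of points of the disc are continuous. [folklore] -/
theorem continuous_disc_coord (i : Fin (1 + 1)) : Continuous fun x : 𝔻² => x.1 i :=
  (PiLp.continuous_apply 2 _ i).comp continuous_subtype_val

/-- Coordinates of points of the circle are continuous. [folklore] -/
theorem continuous_circle_coord (i : Fin (1 + 1)) : Continuous fun u : 𝕊¹ => u.1 i :=
  (PiLp.continuous_apply 2 _ i).comp continuous_subtype_val

/-- The projection is continuous. [folklore] -/
theorem continuous_projD : Continuous projD :=
  (continuous_vec2 (continuous_sphere_coord 0) (continuous_sphere_coord 1)).subtype_mk _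

/-- The height over a point of the disc. [folklore] -/
def hgt (x : 𝔻²) : ℝ := Real.sqrt (1 - (x.1 0 ^ 2 + x.1 1 ^ 2))

/-- The height is continuous. [folklore] -/
theorem continuous_hgt : Continuous hgt :=
  Real.continuous_sqrt.comp (continuous_const.sub (((continuous_disc_coord 0).pow 2).add ((continuous_disc_coord 1).pow 2)))

/-- The disc inequality in coordinates. [folklore] -/
theorem disc_le (x : 𝔻²) : x.1 0 ^ 2 + x.1 1 ^ 2 ≤ 1 := by
  have hx := x.2
  rw [mem_closedBall, dist_zero_right] at hx
  rw [← norm_sq_two]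
  nlinarith [norm_nonneg x.1]

/-- `hgt x ^ 2 = 1 - x₀² - x₁²`. [folklore] -/
theorem hgt_sq (x : 𝔻²) : hgt x ^ 2 = 1 - (x.1 0 ^ 2 + x.1 1 ^ 2) := by
  rw [hgt, Real.sq_sqrt]; linarith [disc_le x]

/-- The height is non-negative. [folklore] -/
theorem hgt_nonneg (x : 𝔻²) : 0 ≤ hgt x := Real.sqrt_nonneg _

/-- The height vanishes on the boundary circle. [folklore] -/
theorem hgt_bd (u : 𝕊¹) : hgt (bd u) = 0 := by
  rw [hgt]; change Real.sqrt (1 - (u.1 0 ^ 2 + u.1 1 ^ 2)) = 0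
  rw [circle_eq u]; simp

/-- **The upper hemisphere** over the disc. [folklore] -/
def hemiUp (x : 𝔻²) : 𝕊² :=
  ⟨!₂[x.1 0, x.1 1, hgt x], mem_sphere_of_sq _ (by simp; nlinarith [hgt_sq x])⟩

/-- **The lower hemisphere** over the disc. [folklore] -/
def hemiDown (x : 𝔻²) : 𝕊² :=
  ⟨!₂[x.1 0, x.1 1, -hgt x], mem_sphere_of_sq _ (by simp; nlinarith [hgt_sq x])⟩

/-- **The equator**. [folklore] -/
def equator (u : 𝕊¹) : 𝕊² :=
  ⟨!₂[u.1 0, u.1 1, 0], mem_sphere_of_sq _ (by simp; exact circle_eq u)⟩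

/-- Continuity of the upper hemisphere. [folklore] -/
theorem continuous_hemiUp : Continuous hemiUp :=
  (continuous_vec3 (continuous_disc_coord 0) (continuous_disc_coord 1) continuous_hgt).subtype_mk _

/-- Continuity of the lower hemisphere. [folklore] -/
theorem continuous_hemiDown : Continuous hemiDown :=
  (continuous_vec3 (continuous_disc_coord 0) (continuous_disc_coord 1) continuous_hgt.neg).subtype_mk _

/-- Continuity of the equator. [folklore] -/
theorem continuous_equator : Continuous equator :=
  (continuous_vec3 (continuous_circle_coord 0) (continuous_circle_coord 1) continuous_const).subtype_mk _

/-- The upper hemisphere restricted to the boundary is the equator. [folklore] -/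
@[simp] theorem hemiUp_bd (u : 𝕊¹) : hemiUp (bd u) = equator u := by
  apply Subtype.ext; simp [hemiUp, equator, hgt_bd]

/-- The lower hemisphere restricted to the boundary is the equator. [folklore] -/
@[simp] theorem hemiDown_bd (u : 𝕊¹) : hemiDown (bd u) = equator u := by
  apply Subtype.ext; simp [hemiDown, equator, hgt_bd]

/-- `projD ∘ hemiUp = id`. [folklore] -/
@[simp] theorem projD_hemiUp (x : 𝔻²) : projD (hemiUp x) = x := by
  apply Subtype.ext; ext i; fin_cases i <;> simp [projD, hemiUp]

/-- `projD ∘ hemiDown = id`. [folklore] -/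
@[simp] theorem projD_hemiDown (x : 𝔻²) : projD (hemiDown x) = x := by
  apply Subtype.ext; ext i; fin_cases i <;> simp [projD, hemiDown]

/-- The height over the projection of a point of the sphere is `|p₂|`. [folklore] -/
theorem hgt_projD (p : 𝕊²) : hgt (projD p) = |p.1 2| := by
  rw [hgt, projD_apply_zero, projD_apply_one, ← Real.sqrt_sq_eq_abs]
  congr 1; linarith [sphere_eq p]

/-- On the upper closed hemisphere, `hemiUp ∘ projD = id`. [folklore] -/
theorem hemiUp_projD {p : 𝕊²} (hp : 0 ≤ p.1 2) : hemiUp (projD p) = p := by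
  apply Subtype.ext; ext i
  fin_cases i
  · simp [hemiUp]
  · simp [hemiUp]
  · simp [hemiUp, hgt_projD, abs_of_nonneg hp]

/-- On the lower closed hemisphere, `hemiDown ∘ projD = id`. [folklore] -/
theorem hemiDown_projD {p : 𝕊²} (hp : p.1 2 ≤ 0) : hemiDown (projD p) = p := by
  apply Subtype.ext; ext i
  fin_cases i
  · simp [hemiDown]
  · simp [hemiDown]
  · simp [hemiDown, hgt_projD, abs_of_nonpos hp]

/-- A point of the equator plane projects to the boundary circle. [folklore] -/
theorem projD_eq_bd {p : 𝕊²} (hp : p.1 2 = 0) :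
    ∃ u : 𝕊¹, projD p = bd u := by
  have hmem : (projD p).1 ∈ 𝕊¹ := by
    rw [mem_sphere_zero_iff_norm]
    have h2 : ‖(projD p).1‖ ^ 2 = 1 := by
      rw [norm_sq_two, projD_apply_zero, projD_apply_one]; nlinarith [sphere_eq p, hp]
    exact (pow_eq_one_iff_of_nonneg (norm_nonneg _) two_ne_zero).mp h2
  exact ⟨⟨(projD p).1, hmem⟩, Subtype.ext rfl⟩

/-- The upper disc of a sphere map. [folklore] -/
def discUp (g : C(𝕊², M)) : C(𝔻², M) := g.comp ⟨hemiUp, continuous_hemiUp⟩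

/-- The lower disc of a sphere map. [folklore] -/
def discDown (g : C(𝕊², M)) : C(𝔻², M) := g.comp ⟨hemiDown, continuous_hemiDown⟩

/-- Values of the upper disc. [folklore] -/
@[simp] theorem discUp_apply (g : C(𝕊², M)) (x : 𝔻²) : discUp g x = g (hemiUp x) := rfl

/-- Values of the lower disc. [folklore] -/
@[simp] theorem discDown_apply (g : C(𝕊², M)) (x : 𝔻²) : discDown g x = g (hemiDown x) := rfl

/-- The upper disc restricted to the boundary is the equator map. [folklore] -/
theorem discUp_bd (g : C(𝕊², M)) (u : 𝕊¹) : (discUp g ∘ bd) u = (g ∘ equator) u := by simp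

/-- The lower disc restricted to the boundary is the equator map. [folklore] -/
theorem discDown_bd (g : C(𝕊², M)) (u : 𝕊¹) : (discDown g ∘ bd) u = (g ∘ equator) u := by simp

/-- **Gluing two disc maps with the same boundary into a sphere map.** [folklore] -/
def glue (D₁ D₂ : C(𝔻², M)) (h : ∀ u, D₁ (bd u) = D₂ (bd u)) : C(𝕊², M) :=
  ⟨fun p => if 0 ≤ p.1 2 then D₁ (projD p) else D₂ (projD p), by
    refine Continuous.if_le (D₁.2.comp continuous_projD) (D₂.2.comp continuous_projD) continuous_const
      (continuous_sphere_coord 2) fun p hp => ?_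
    obtain ⟨u, hu⟩ := projD_eq_bd hp.symm
    rw [hu]; exact h u⟩

/-- The upper disc of the glued sphere is the first disc. [folklore] -/
@[simp] theorem discUp_glue (D₁ D₂ : C(𝔻², M)) (h : ∀ u, D₁ (bd u) = D₂ (bd u)) : discUp (glue D₁ D₂ h) = D₁ := by
  ext x
  change (if 0 ≤ (hemiUp x).1 2 then D₁ (projD (hemiUp x)) else D₂ (projD (hemiUp x))) = D₁ x
  rw [if_pos (by simp [hemiUp, hgt_nonneg]), projD_hemiUp]

/-- The lower disc of the glued sphere is the second disc. [folklore] -/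
@[simp] theorem discDown_glue (D₁ D₂ : C(𝔻², M)) (h : ∀ u, D₁ (bd u) = D₂ (bd u)) : discDown (glue D₁ D₂ h) = D₂ := by
  ext x
  change (if 0 ≤ (hemiDown x).1 2 then D₁ (projD (hemiDown x)) else D₂ (projD (hemiDown x))) = D₂ x
  by_cases h0 : hgt x = 0
  · rw [if_pos (by simp [hemiDown, h0]), projD_hemiDown]
    -- `x` lies on the boundary circle
    have hx1 : x.1 0 ^ 2 + x.1 1 ^ 2 = 1 := by
      have := hgt_sq x; rw [h0] at this; linarith
    have hmem : x.1 ∈ 𝕊¹ := by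
      rw [mem_sphere_zero_iff_norm]
      exact (pow_eq_one_iff_of_nonneg (norm_nonneg _) two_ne_zero).mp (by rw [norm_sq_two]; exact hx1)
    have hxb : x = bd ⟨x.1, hmem⟩ := Subtype.ext rfl
    rw [hxb]; exact h _
  · have hlt : ¬ (0 ≤ (hemiDown x).1 2) := by
      simp [hemiDown]; exact lt_of_le_of_ne (hgt_nonneg x) (Ne.symm h0)
    rw [if_neg hlt, projD_hemiDown]

variable [IsManifold (𝓡 m) 1 M]

/-- Equal-valued loops of invertible matrices have the same class. [folklore] -/
theorem clsGL_congr_val {n : ℕ} {L L' : C(𝕊¹, NzMat (n + 1))} (h : ∀ u, (L u).1 = (L' u).1) : clsGL L = clsGL L' := by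
  have : L = L' := by ext u : 1; exact Subtype.ext (h u)
  rw [this]

/-- **A framed sphere has equal hemisphere classes**: if `TM ⊕ ℝ` is framed along `g : 𝕊² → M`
then for every stable frame `F` along the equator map, `e(F, D₊) = e(F, D₋)` for the two discs
`D± = g ∘ hemi±` of `g`. [folklore] -/
theorem eClass_discUp_eq_discDown_of_framed (hm : 2 ≤ m) (g : C(𝕊², M)) {F : 𝕊¹ → Fr m}
    (hF : IsStableFrameFieldOn (g ∘ equator) F univ) (h : HasStableTangentFramingAlong (𝓡 m) M g) :
    eClass (discUp g) F (hF.congr_map fun u _ => discUp_bd g u) =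
      eClass (discDown g) F (hF.congr_map fun u _ => discDown_bd g u) := by
  obtain ⟨Fg, hFg⟩ := h.exists_isStableFrameFieldOn
  have hGu : IsStableFrameFieldOn (discUp g) (Fg ∘ hemiUp) univ := hFg.comp continuous_hemiUp.continuousOn (mapsTo_univ _ _)
  have hGd : IsStableFrameFieldOn (discDown g) (Fg ∘ hemiDown) univ := hFg.comp continuous_hemiDown.continuousOn (mapsTo_univ _ _)
  rw [eClass_eq hm _ hGu, eClass_eq hm _ hGd]
  refine clsGL_congr_val fun u => ?_
  simp only [compLoopGL_apply_val, Function.comp_apply, hemiUp_bd, hemiDown_bd]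

/-- **Extension over the disc of a loop of invertible matrices of class `0`** (converse of
`clsGL_eq_zero_of_extends`; the tree's `exists_sphere_extends_of_nullhomotopic`). [folklore] -/
theorem exists_extends_of_clsGL_eq_zero {n : ℕ} (L : C(𝕊¹, NzMat (n + 1))) (h : clsGL L = 0) :
    ∃ E : C(𝔻², NzMat (n + 1)), ∀ u, E (bd u) = L u := by
  unfold clsGL at h
  rw [cls_eq_zero_iff] at h
  obtain ⟨G, hG⟩ := exists_sphere_extends_of_nullhomotopic (toPos L) h
  by_cases hs : 0 < (L u₀).1.det
  · refine ⟨⟨fun x => ⟨(G x.1).1, (G x.1).2.ne'⟩,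
      ((PosMat.continuous_val.comp (G.2.comp continuous_subtype_val))).subtype_mk fun x => (G x.1).2.ne'⟩,
      fun u => Subtype.ext ?_⟩
    change (G (bd u).1).1 = (L u).1
    rw [bd_val, hG u, toPos_of_pos L hs]
  · have hneg : (L u₀).1.det < 0 := lt_of_le_of_ne (not_lt.mp hs) (L u₀).2
    have hdet : ∀ x : 𝔻², (NzMat.P0 (n + 1) * (G x.1).1).det ≠ 0 := fun x => by
      rw [det_mul, NzMat.det_P0]; exact mul_ne_zero (by norm_num) (G x.1).2.ne'
    refine ⟨⟨fun x => ⟨NzMat.P0 (n + 1) * (G x.1).1, hdet x⟩,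
      (continuous_const.mul (PosMat.continuous_val.comp (G.2.comp continuous_subtype_val))).subtype_mk fun x => hdet x⟩,
      fun u => Subtype.ext ?_⟩
    change NzMat.P0 (n + 1) * (G (bd u).1).1 = (L u).1
    rw [bd_val, hG u, toPos_of_neg L hneg, ← Matrix.mul_assoc, NzMat.P0_mul_P0, Matrix.one_mul]

/-- **Gluing frame fields over the two hemispheres**: if `e(F, D₊) = e(F, D₋)` for the discs of a
sphere map `g` and some stable frame `F` along its equator, then `TM ⊕ ℝ` is framed along `g`.
*Proof.* Disc frames `G₊`, `G₋` over `D±`; the comparison loop `Λ` of their boundary values has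
class `e(F, D₋) - e(F, D₊) = 0`, hence extends over the disc; twisting `G₋` by the extension makes
the two disc frames agree on the equator, and they paste to a framing along `g`. [folklore] -/
theorem framed_of_eClass_discUp_eq_discDown (hm : 2 ≤ m) (g : C(𝕊², M)) {F : 𝕊¹ → Fr m}
    (hF : IsStableFrameFieldOn (g ∘ equator) F univ)
    (h : eClass (discUp g) F (hF.congr_map fun u _ => discUp_bd g u) =
      eClass (discDown g) F (hF.congr_map fun u _ => discDown_bd g u)) :
    HasStableTangentFramingAlong (𝓡 m) M g := by
  classical
  set Gu : 𝔻² → Fr m := discFrame (discUp g)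
  set Gd : 𝔻² → Fr m := discFrame (discDown g)
  have hGu : IsStableFrameFieldOn (discUp g) Gu univ := discFrame_spec _
  have hGd : IsStableFrameFieldOn (discDown g) Gd univ := discFrame_spec _
  -- boundary fields, along the equator map
  have hGub : IsStableFrameFieldOn (g ∘ equator) (Gu ∘ bd) univ := hGu.bd.congr_map fun u _ => (discUp_bd g u).symm
  have hGdb : IsStableFrameFieldOn (g ∘ equator) (Gd ∘ bd) univ := hGd.bd.congr_map fun u _ => (discDown_bd g u).symm
  -- the comparison loop `Λ` of the two boundary frames has class `0`
  set Λ := compLoopGL (Gu ∘ bd) (Gd ∘ bd) hGub hGdb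
  have hΛ : clsGL Λ = 0 := by
    have hu : eClass (discUp g) F (hF.congr_map fun u _ => discUp_bd g u) = clsGL (compLoopGL F (Gu ∘ bd) hF hGub) := rfl
    have hd : eClass (discDown g) F (hF.congr_map fun u _ => discDown_bd g u) = clsGL (compLoopGL F (Gd ∘ bd) hF hGdb) := rfl
    rw [hu, hd, ← compLoopGL_mul hF hGub hGdb, clsGL_mul (by omega)] at h
    have : ∀ a b : ZMod 2, a = b + a → b = 0 := by decide
    exact this _ _ h
  obtain ⟨E, hE⟩ := exists_extends_of_clsGL_eq_zero Λ hΛ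
  -- twist the lower disc frame
  set Gd' : 𝔻² → Fr m := fun x => act (Gd x) (E x).1
  have hGd' : IsStableFrameFieldOn (discDown g) Gd' univ :=
    hGd.act (NzMat.continuous_val.comp E.2).continuousOn fun x _ => (E x).2
  have hagree : ∀ u, Gd' (bd u) = Gu (bd u) := fun u => by
    change act (Gd (bd u)) (E (bd u)).1 = Gu (bd u)
    rw [hE u]
    exact act_compMat (hGdb.2.2 u (mem_univ u))
  -- paste over the closed hemispheres
  set R : Set 𝕊² := {p | 0 ≤ p.1 2}
  set P : Set 𝕊² := {p | p.1 2 ≤ 0}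
  have hR : IsClosed R := isClosed_le continuous_const (continuous_sphere_coord 2)
  have hP : IsClosed P := isClosed_le (continuous_sphere_coord 2) continuous_const
  have hFR : IsStableFrameFieldOn g (Gu ∘ projD) R :=
    (hGu.comp continuous_projD.continuousOn (mapsTo_univ _ R)).congr_map fun p hp => by
      change g p = g (hemiUp (projD p)); rw [hemiUp_projD hp]
  have hFP : IsStableFrameFieldOn g (Gd' ∘ projD) P :=
    (hGd'.comp continuous_projD.continuousOn (mapsTo_univ _ P)).congr_map fun p hp => by
      change g p = g (hemiDown (projD p)); rw [hemiDown_projD hp]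
  have hunion := IsStableFrameFieldOn.union hFR hFP hR hP fun p hp => by
    obtain ⟨u, hu⟩ := projD_eq_bd (le_antisymm hp.2 hp.1)
    change Gu (projD p) = Gd' (projD p)
    rw [hu, hagree]
  have huniv : R ∪ P = univ := by
    ext p; simp only [mem_union, mem_setOf_eq, mem_univ, iff_true, R, P]; exact le_total _ _
  rw [huniv] at hunion
  exact hunion.hasStableTangentFramingAlong

/-- **The obstruction `κ` in terms of extension classes**: `TM ⊕ ℝ` is framed along a sphere map `g`
iff `e(F, D₊) = e(F, D₋)` for its two discs and one (equivalently every) stable frame `F` along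
the equator map. [cite: Kirby1989, Ch. IV p. 33; Ch. II §4 p. 27 (w₂ as the obstruction over the 2-skeleton)] -/
theorem framed_iff_eClass_eq (hm : 2 ≤ m) (g : C(𝕊², M)) {F : 𝕊¹ → Fr m}
    (hF : IsStableFrameFieldOn (g ∘ equator) F univ) :
    HasStableTangentFramingAlong (𝓡 m) M g ↔
      eClass (discUp g) F (hF.congr_map fun u _ => discUp_bd g u) =
        eClass (discDown g) F (hF.congr_map fun u _ => discDown_bd g u) :=
  ⟨eClass_discUp_eq_discDown_of_framed hm g hF, framed_of_eClass_discUp_eq_discDown hm g hF⟩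

/-- There is always a stable frame along the equator map (restrict a disc frame). [folklore] -/
theorem exists_frame_equator (g : C(𝕊², M)) : ∃ F : 𝕊¹ → Fr m, IsStableFrameFieldOn (g ∘ equator) F univ :=
  ⟨discFrame (discUp g) ∘ bd, (discFrame_spec (discUp g)).bd.congr_map fun u _ => (discUp_bd g u).symm⟩

/-- **Gluing criterion**: the sphere glued from two discs with common boundary is framed iff the
two extension classes agree. [folklore] -/
theorem framed_glue_iff (hm : 2 ≤ m) (D₁ D₂ : C(𝔻², M)) (hD : ∀ u, D₁ (bd u) = D₂ (bd u))
    {F : 𝕊¹ → Fr m} (hF : IsStableFrameFieldOn (D₁ ∘ bd) F univ) :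
    HasStableTangentFramingAlong (𝓡 m) M (glue D₁ D₂ hD) ↔
      eClass D₁ F hF = eClass D₂ F (hF.congr_map fun u _ => (hD u).symm) := by
  have hF' : IsStableFrameFieldOn (glue D₁ D₂ hD ∘ equator) F univ := hF.congr_map fun u _ => by
    have := discUp_bd (glue D₁ D₂ hD) u
    rw [discUp_glue] at this
    exact this.symm
  rw [framed_iff_eClass_eq hm (glue D₁ D₂ hD) hF']
  constructor <;> intro h
  · convert h using 2 <;> simp
  · convert h using 2 <;> simp

/-- The sphere glued from a disc with itself is framed. [folklore] -/
theorem framed_glue_self (hm : 2 ≤ m) (D : C(𝔻², M)) :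
    HasStableTangentFramingAlong (𝓡 m) M (glue D D fun _ => rfl) := by
  rw [framed_glue_iff hm D D (fun _ => rfl) (discFrame_spec D).bd]

end Sphere

end StableFrames

end Literature.Topology.FourManifolds
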